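import Literature.Analysis.FluidPDE.LocalLerayInitialLEISpaceTime
import Literature.Analysis.FluidPDE.JiaSverak2014SlabPressureGauge
import Literature.Analysis.FluidPDE.DistributionalToWeakPressure
import Literature.Analysis.FluidPDE.LocalLeraySlabGoodSlices
import Literature.Analysis.FluidPDE.LocalEnergyConcatenation
import Literature.Analysis.FluidPDE.WholeSpaceIBP
import HarnessLib

/-!
# Jia–Šverák 2014, §4 claim: continuation of a Leray solution to negative times by its datum

Analysis/FluidPDE proofs file (theorems only, no definitions, no named facts), first file of
the proof of the named fact `Literature.Analysis.FluidPDE.jia_sverak_2014_local_higher_regularity`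
(`JiaSverak2014LocalRegularity.lean`; H. Jia, V. Šverák, *Local-in-space estimates near initial
time for weak solutions of the Navier–Stokes equations and forward self-similar solutions*,
Invent. Math. 196 (2014) = arXiv:1204.0529, §4, proof of Thm. 4.1: "since `u₀ ∈ C^∞(B₄(x₀))`,
we can apply Theorem 3.1 and some simple bootstrapping arguments to show [...]
`‖∂ₜ∂ₓ^α u‖_{L^∞(B_{1/8}(x₀)×[0,T₂])} ≤ C(α,u₀)`").

The printed route to regularity *up to the initial time* (proof of Thm. 3.1, arXiv p. 8) extends
the perturbation `v = u - a` of the Leray solution by the mild flow `a` **by zero to negative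
times** ("we can extend `v` to negative time by setting `v = 0` for `t < 0`; the extended `v`
[...] satisfies the perturbed system in `B_{4/3} × (-∞, T₂)`") and applies an ε-regularity
theorem for the *perturbed* system (their Thm. 2.2) on cylinders of unit size reaching across
`t = 0`. For locally **smooth** data the same idea can be run on the Leray solution itself, with
the tree's *proved* ε-regularity theorem **with a force** (Lemarié-Rieusset 2016, Thm. 14.4,
`lemarieRieusset_epsilon_regularity_holds`) in place of the perturbed one: continue `u` to
negative times **by its datum** — more precisely by a `C²` field `e` that agrees with `u₀` and is
divergence free on a ball `B_ρ(x₀)` — with pressure `0` and the steady force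
`f₀ = (e·∇)e - Δe`. This file proves that the continued pair

  `ū = 1_{t≤0} e + 1_{t>0} u`,  `p̄ = 1_{t>0} p`,  `f̄ = 1_{t≤0} f₀`,  `Ḡ = 1_{t≤0} De + 1_{t>0} ∇u`

satisfies, on `Q = (-1, T₀) × B_ρ(x₀)` (`0 < T₀ ≤ T'`), every hypothesis of that theorem:

* `JiaSverak2014.isConnected_Q`, `exists_energyClass_Q` (`ū ∈ L^∞_t L²_x(Q)`),
  `hasWeakSpatialGradientOn_Q` (`Ḡ` is a weak spatial gradient of `ū` on `Q`),
  `lintegral_Gc_sq_lt_top` (`∇ū ∈ L²(Q)`), `lintegral_pc_lt_top` (`p̄ ∈ L^{3/2}(Q)`),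
  `memLp_fc` (`f̄ ∈ L³(Q)`);
* `JiaSverak2014.isDistributionalNSSolutionOn_Q` — `(ū, p̄)` solves the Navier–Stokes system
  with force `f̄` in `𝒟'(Q)`: across `t = 0` the weak form of the Leray solution **with its datum**
  (`weakIdentity_datum_pressure_of_distributional`, Robinson–Rodrigo–Sadowski 2016, (3.1))
  produces `-∫ ⟪u₀, ψ(0)⟫`, while the steady half produces `+∫ ⟪e, ψ(0)⟫` (fundamental theorem of
  calculus in `t`), and `e = u₀` on the support of `ψ(0)`;
* `JiaSverak2014.localEnergyIneq_Q` — `(ū, p̄)` is **suitable** on `Q`: the local energy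
  inequality of the Leray solution **from the initial time** for space–time test functions
  (`IsLocalLeraySolutionOn.localEnergyIneq_initial`, Lemarié-Rieusset 2016, (14.11)) carries
  `+∫ |u₀|² φ(0)` on its right, and the localised energy *identity* of the steady field
  (`steady_integral_mul_frobeniusNormSq_eq`, test `-Δe + (e·∇)e = f₀` against `φe`) leaves
  exactly `∫∫_{t<0} |e|² ∂ₜφ = ∫ |e|² φ(0)` after integration in `t`.

The continued fields are any fields with the stated values below and above `t = 0` (hypotheses
`hu₁/hu₂, hp₁/hp₂, hf₁/hf₂, hG₁/hG₂`, the format of `LocalEnergyConcat.concat`), so that no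
definition is introduced. The smallness verification and the boundedness conclusion are in the
sequel `JiaSverak2014LocalBoundedness.lean`.

## Mathlib / tree search

Tree (all used): `IsLocalLeraySolutionOn` and its slab API (`integrableOn_velocity/pressure`,
`localEnergyIneq_initial`, `integrableOn_localEnergyRHS_slab` — `LocalLeraySlabCubicIntegrability`,
`LocalLerayInitialLEISpaceTime`), `weakIdentity_datum_pressure_of_distributional`
(`DistributionalToWeakPressure`), `IsDistributionalNSSolutionOn.isWeakNSSolutionOn_datum`,
`ae_slice_aestronglyMeasurable_and_lintegral_ball_lt_top` (`DistributionalToWeak`),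
`HasWeakSpatialGradientOn.ae_hasWeakFDerivOn_slice_slab` (`LocalLeraySlabGoodSlices`), the
splitting tools `LocalEnergyConcat.setIntegral_split/integrableOn_of_split/setLIntegral_split_le`,
`integrableOn_grad_cylinder`, `integral_fderiv_mul_inner_of_hasWeakFDerivOn`,
`isTestFunctionOn_slice'` (`LocalEnergyConcatenation`), the whole-space integrations by parts
`integral_inner_convect_add_eq_zero`, `integral_inner_laplacian_add_eq_zero`,
`integral_mul_divergence_add_eq_zero_left`, `HasWeakGradient.of_contDiff_holds` (`WholeSpaceIBP`),
`integrableOn_frobeniusNormSq_mul_slab` (`LocalEnergyInitialLEI`),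
`integrable_inner_of_locallyIntegrableOn` (`SuitableWeakPressure`), the template
`IsLerayProfile.integral_mul_frobeniusNormSq_eq` (`SteadyNSLocalEnergy`). Mathlib:
`integral_prod`, `integral_integral_swap`, `intervalIntegral.integral_eq_sub_of_hasDerivAt`,
`setIntegral_eq_of_subset_of_forall_sdiff_eq_zero`, `Measure.integrableOn_of_bounded`,
`MemLp.of_bound`.

## References

* H. Jia, V. Šverák, Invent. Math. 196 (2014) 233–265 = arXiv:1204.0529: §3, proof of Thm. 3.1
  (extension by zero to negative times, arXiv p. 8); §4, proof of Thm. 4.1 (the claim for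
  `|x₀| = 8`). Bib key `JiaSverak2014`.
* P. G. Lemarié-Rieusset, *The Navier–Stokes Problem in the 21st Century*, CRC Press (2016):
  Thm. 14.4 (p. 505); (14.11) (p. 498). Bib key `LemarieRieusset2016`.
* J. C. Robinson, J. L. Rodrigo, W. Sadowski, *The Three-Dimensional Navier–Stokes Equations*
  (CUP 2016), §3.1, (3.1) (weak form with datum).
* G. Seregin, W. Wang, St. Petersburg Math. J. 31 (2020) = arXiv:1805.02227, proof of Prop. 2.1
  (the localised energy identity of a steady field). Bib key `SereginWang2020`.
-/

noncomputable section

open MeasureTheory TopologicalSpace Set Function Filter Metric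
open _root_.Topology
open scoped ENNReal NNReal RealInnerProductSpace Laplacian ContDiff

namespace Literature.Analysis.FluidPDE

namespace JiaSverak2014

open LocalEnergyConcat

/-! ## §A. The steady field: slice identities

Throughout this section `e : ℝ³ → ℝ³` is a `C²` field (in the application, a smooth cut-off of
the datum) and the test functions are supported in a region where `div e = 0`. The "force" of
the steady field is `f₀ = (e·∇)e - Δe`, so that `-Δe + (e·∇)e = f₀` (pressure `0`). -/

section Steady

variable {e : EuclideanSpace ℝ (Fin 3) → EuclideanSpace ℝ (Fin 3)}

/-- **Weak divergence-freeness of the steady field on its solenoidal region**: if `div e = 0`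
on `tsupport θ`, then `∫ ⟪e, ∇θ⟫ = 0` (`∫ θ div e + ∫ ⟪e, ∇θ⟫ = 0`). [folklore] -/
theorem steady_integral_inner_gradient_eq_zero (he : ContDiff ℝ 1 e)
    {θ : EuclideanSpace ℝ (Fin 3) → ℝ} (hθ : ContDiff ℝ 1 θ) (hθc : HasCompactSupport θ)
    (hdiv : ∀ x ∈ tsupport θ, VectorCalculus.divergence e x = 0) :
    ∫ x, ⟪e x, gradient θ x⟫ = 0 := by
  have h := integral_mul_divergence_add_eq_zero_left hθ he hθc
  have h0 : ∫ x, θ x * VectorCalculus.divergence e x = 0 := by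
    rw [← integral_zero (α := EuclideanSpace ℝ (Fin 3)) (G := ℝ)]
    refine integral_congr_ae (Eventually.of_forall fun x => ?_)
    show θ x * VectorCalculus.divergence e x = 0
    by_cases hx : x ∈ tsupport θ
    · rw [hdiv x hx, mul_zero]
    · rw [image_eq_zero_of_notMem_tsupport hx, zero_mul]
  rw [h0, zero_add] at h
  exact h

/-- **The steady field pairs with its classical gradient as a weak gradient**:
`∫ ∂ₐφ ⟪e, b⟫ = -∫ φ ⟪De a, b⟫` for every spatial test function `φ` (a `C¹` field has its
classical derivative as weak derivative, `HasWeakGradient.of_contDiff_holds`). [folklore] -/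
theorem steady_integral_fderiv_mul_inner (he : ContDiff ℝ 1 e)
    {φ : EuclideanSpace ℝ (Fin 3) → ℝ}
    (hφ : FunctionSpaces.IsTestFunctionOn (⊤ : Opens (EuclideanSpace ℝ (Fin 3))) φ)
    (a b : EuclideanSpace ℝ (Fin 3)) :
    ∫ x, fderiv ℝ φ x a * ⟪e x, b⟫ = -∫ x, φ x * ⟪fderiv ℝ e x a, b⟫ :=
  integral_fderiv_mul_inner_of_hasWeakFDerivOn (HasWeakGradient.of_contDiff_holds he) hφ a b

/-- **The steady momentum identity, tested**: for `e ∈ C²` with `div e = 0` on `tsupport ψ`,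
`∫ (⟪e, (e·∇)ψ⟫ + ⟪e, Δψ⟫ + ⟪(e·∇)e - Δe, ψ⟫) = 0` — i.e. `(e, 0)` solves the steady
Navier–Stokes system with force `f₀ = (e·∇)e - Δe` in the sense of distributions on the
solenoidal region (trilinear identity and Green's identity, no boundary terms). [folklore] -/
theorem steady_integral_momentum_eq_zero (he : ContDiff ℝ 2 e)
    {ψ : EuclideanSpace ℝ (Fin 3) → EuclideanSpace ℝ (Fin 3)} (hψ : ContDiff ℝ 2 ψ)
    (hψc : HasCompactSupport ψ)
    (hdiv : ∀ x ∈ tsupport ψ, VectorCalculus.divergence e x = 0) :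
    ∫ x, (⟪e x, convect e ψ x⟫ + ⟪e x, (Δ ψ) x⟫ + ⟪convect e e x - (Δ e) x, ψ x⟫) = 0 := by
  set b := stdOrthonormalBasis ℝ (EuclideanSpace ℝ (Fin 3)) with hb
  have he1 : ContDiff ℝ 1 e := he.of_le one_le_two
  have hψ1 : ContDiff ℝ 1 ψ := hψ.of_le one_le_two
  have hec : Continuous e := he1.continuous
  have hDec : Continuous (fderiv ℝ e) := he1.continuous_fderiv one_ne_zero
  have hψcn : Continuous ψ := hψ1.continuous
  have hDψc : Continuous (fderiv ℝ ψ) := hψ1.continuous_fderiv one_ne_zero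
  have hΔec : Continuous (Δ e) := continuous_laplacian he
  have hΔψc : Continuous (Δ ψ) := continuous_laplacian hψ
  have hDψcs : HasCompactSupport (fderiv ℝ ψ) := hψc.fderiv (𝕜 := ℝ)
  have hΔψcs : HasCompactSupport (Δ ψ) := hψc.mono' fun x hx => by
    contrapose! hx; simp [laplacian_eq_zero_of_notMem_tsupport hx]
  -- (1) the trilinear identity: `∫⟪(e·∇)e, ψ⟫ + ∫⟪e, (e·∇)ψ⟫ + ∫ div e ⟪e, ψ⟫ = 0`
  have conv := integral_inner_convect_add_eq_zero (F' := EuclideanSpace ℝ (Fin 3)) he1 he1 hψ1 hψc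
  have hconv3 : ∫ x, VectorCalculus.divergence e x * ⟪e x, ψ x⟫ = 0 := by
    rw [← integral_zero (α := EuclideanSpace ℝ (Fin 3)) (G := ℝ)]
    refine integral_congr_ae (Eventually.of_forall fun x => ?_)
    show VectorCalculus.divergence e x * ⟪e x, ψ x⟫ = 0
    by_cases hx : x ∈ tsupport ψ
    · rw [hdiv x hx, zero_mul]
    · rw [image_eq_zero_of_notMem_tsupport hx, inner_zero_right, mul_zero]
  rw [hconv3, add_zero] at conv
  -- (2) Green twice: `∫⟪Δψ, e⟫ = -Σ∫⟪∂ᵢψ, ∂ᵢe⟫ = ∫⟪Δe, ψ⟫`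
  have green1 := integral_inner_laplacian_add_eq_zero b hψ he1 (Or.inl hψc)
  have green2 := integral_inner_laplacian_add_eq_zero b he hψ1 (Or.inr hψc)
  have hsym : ∑ i, ∫ x, ⟪fderiv ℝ ψ x (b i), fderiv ℝ e x (b i)⟫ =
      ∑ i, ∫ x, ⟪fderiv ℝ e x (b i), fderiv ℝ ψ x (b i)⟫ :=
    Finset.sum_congr rfl fun i _ => integral_congr_ae (Eventually.of_forall fun x =>
      real_inner_comm _ _)
  have hlap : ∫ x, ⟪e x, (Δ ψ) x⟫ = ∫ x, ⟪(Δ e) x, ψ x⟫ := by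
    have e1 : ∫ x, ⟪e x, (Δ ψ) x⟫ = ∫ x, ⟪(Δ ψ) x, e x⟫ :=
      integral_congr_ae (Eventually.of_forall fun x => real_inner_comm _ _)
    rw [e1]
    linarith
  -- integrability of the three pieces
  have hI1 : Integrable (fun x => ⟪e x, convect e ψ x⟫) := by
    refine (hec.inner (hDψc.clm_apply hec)).integrable_of_hasCompactSupport ?_
    refine hDψcs.mono fun x hx => ?_
    contrapose! hx
    simp only [mem_support, not_not] at hx
    simp [convect, hx]
  have hI2 : Integrable (fun x => ⟪e x, (Δ ψ) x⟫) :=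
    (hec.inner hΔψc).integrable_of_hasCompactSupport
      (hΔψcs.mono fun x hx => by contrapose! hx; simp_all)
  have hI3 : Integrable (fun x => ⟪convect e e x - (Δ e) x, ψ x⟫) :=
    (((hDec.clm_apply hec).sub hΔec).inner hψcn).integrable_of_hasCompactSupport
      (hψc.mono fun x hx => by contrapose! hx; simp_all)
  rw [integral_add _ hI3, integral_add hI1 hI2, hlap]
  swap; · exact hI1.add hI2
  have e3 : ∫ x, ⟪convect e e x - (Δ e) x, ψ x⟫ =
      (∫ x, ⟪convect e e x, ψ x⟫) - ∫ x, ⟪(Δ e) x, ψ x⟫ := by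
    rw [← integral_sub]
    · exact integral_congr_ae (Eventually.of_forall fun x => inner_sub_left _ _ _)
    · exact ((hDec.clm_apply hec).inner hψcn).integrable_of_hasCompactSupport
        (hψc.mono fun x hx => by contrapose! hx; simp_all)
    · exact (hΔec.inner hψcn).integrable_of_hasCompactSupport
        (hψc.mono fun x hx => by contrapose! hx; simp_all)
  rw [e3]
  linarith

/-- **The localised energy identity of the steady field** (test the steady equation
`-Δe + (e·∇)e = f₀` against `φ e`; Seregin–Wang 2020, proof of Prop. 2.1, here with the force
kept): for `e ∈ C²`, `φ ∈ C²_c` and `div e = 0` on `tsupport φ`,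
`∫ φ |De|² = ½ ∫ (Δφ) |e|² + ½ ∫ (Dφ·e) |e|² + ∫ φ ⟪f₀, e⟫`, `f₀ = (e·∇)e - Δe`, `|De|²` the
Frobenius norm (`frobeniusNormSq`). The tree's `IsLerayProfile.integral_mul_frobeniusNormSq_eq`
is the case of a genuine steady solution (`f₀ = -∇p`); the proof is the same. [cite: SereginWang2020, proof of Prop. 2.1 (the localised energy identity)] -/
theorem steady_integral_mul_frobeniusNormSq_eq (he : ContDiff ℝ 2 e)
    {φ : EuclideanSpace ℝ (Fin 3) → ℝ} (hφ : ContDiff ℝ 2 φ) (hφc : HasCompactSupport φ)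
    (hdiv : ∀ x ∈ tsupport φ, VectorCalculus.divergence e x = 0) :
    ∫ x, φ x * frobeniusNormSq (fderiv ℝ e x) =
      2⁻¹ * (∫ x, (Δ φ) x * ‖e x‖ ^ 2) + 2⁻¹ * (∫ x, fderiv ℝ φ x (e x) * ‖e x‖ ^ 2) +
        ∫ x, φ x * ⟪convect e e x - (Δ e) x, e x⟫ := by
  set b := stdOrthonormalBasis ℝ (EuclideanSpace ℝ (Fin 3)) with hb
  set u := e with hu_def
  -- regularity
  have hu2 : ContDiff ℝ 2 u := he
  have hu1 : ContDiff ℝ 1 u := hu2.of_le one_le_two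
  have hφ1 : ContDiff ℝ 1 φ := hφ.of_le one_le_two
  have hud : ∀ x, DifferentiableAt ℝ u x := fun x => hu1.differentiable one_ne_zero x
  have hφd : ∀ x, DifferentiableAt ℝ φ x := fun x => hφ1.differentiable one_ne_zero x
  have huc : Continuous u := hu1.continuous
  have hDuc : Continuous (fderiv ℝ u) := hu1.continuous_fderiv one_ne_zero
  have hΔuc : Continuous (Δ u) := continuous_laplacian hu2
  have hφcn : Continuous φ := hφ1.continuous
  have hDφc : Continuous (fderiv ℝ φ) := hφ1.continuous_fderiv one_ne_zero
  set w : EuclideanSpace ℝ (Fin 3) → EuclideanSpace ℝ (Fin 3) := fun x => φ x • u x with hw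
  have hw1 : ContDiff ℝ 1 w := hφ1.smul hu1
  have hwc : HasCompactSupport w := hφc.smul_right
  have hDφcs : HasCompactSupport (fderiv ℝ φ) := hφc.fderiv (𝕜 := ℝ)
  -- `w`, and hence `div u ⟪u, w⟫`, vanishes off `tsupport φ`
  have hw0 : ∀ x ∉ tsupport φ, w x = 0 := fun x hx => by
    simp only [hw, image_eq_zero_of_notMem_tsupport hx, zero_smul]
  -- the derivative of `w = φu`
  have hDw : ∀ x v, fderiv ℝ w x v = fderiv ℝ φ x v • u x + φ x • fderiv ℝ u x v := fun x v => by
    rw [hw, fderiv_fun_smul (hφd x) (hud x)]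
    simp [add_comm]
  -- (1) the "equation" tested against `w`: `⟪Δu, w⟫ = φ ⟪(u·∇)u, u⟫ - φ ⟪f₀, u⟫`
  have heq : ∀ x, ⟪(Δ u) x, w x⟫ =
      φ x * ⟪convect u u x, u x⟫ - φ x * ⟪convect u u x - (Δ u) x, u x⟫ := by
    intro x
    rw [hw]
    simp only [real_inner_smul_right, inner_sub_left]
    ring
  -- (2) Green's identity for `v = u`, `w = φu`
  have green1 := integral_inner_laplacian_add_eq_zero b hu2 hw1 (Or.inr hwc)
  have hpair : ∀ x, ∑ i, ⟪fderiv ℝ u x (b i), fderiv ℝ w x (b i)⟫ =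
      (∑ i, fderiv ℝ φ x (b i) * ⟪fderiv ℝ u x (b i), u x⟫) +
        φ x * frobeniusNormSq (fderiv ℝ u x) := by
    intro x
    rw [frobeniusNormSq_eq_sum b, Finset.mul_sum, ← Finset.sum_add_distrib]
    refine Finset.sum_congr rfl fun i _ => ?_
    rw [hDw x (b i), inner_add_right, real_inner_smul_right, real_inner_smul_right,
      real_inner_self_eq_norm_sq]
  -- (3) Green's identity for `v = φ`, `w = |u|²`
  set g : EuclideanSpace ℝ (Fin 3) → ℝ := fun x => ‖u x‖ ^ 2 with hg
  have hg_inner : g = fun x => ⟪u x, u x⟫ := funext fun x => by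
    rw [hg, real_inner_self_eq_norm_sq]
  have hg1 : ContDiff ℝ 1 g := by rw [hg_inner]; exact hu1.inner ℝ hu1
  have hDg : ∀ x v, fderiv ℝ g x v = 2 * ⟪fderiv ℝ u x v, u x⟫ := fun x v => by
    rw [hg_inner, fderiv_inner_apply ℝ (hud x) (hud x) v, real_inner_comm]
    ring
  have green2 := integral_inner_laplacian_add_eq_zero b (F' := ℝ) hφ hg1 (Or.inl hφc)
  have hg2a : ∫ x, ⟪(Δ φ) x, g x⟫ = ∫ x, (Δ φ) x * ‖u x‖ ^ 2 :=
    integral_congr_ae (Eventually.of_forall fun x => by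
      simp only [hg, RCLike.inner_apply, conj_trivial, mul_comm])
  have hg2b : ∀ i, ∫ x, ⟪fderiv ℝ φ x (b i), fderiv ℝ g x (b i)⟫ =
      2 * ∫ x, fderiv ℝ φ x (b i) * ⟪fderiv ℝ u x (b i), u x⟫ := fun i => by
    rw [← integral_const_mul]
    refine integral_congr_ae (Eventually.of_forall fun x => ?_)
    simp only [RCLike.inner_apply, conj_trivial, hDg]
    ring
  -- (4) the trilinear identity
  have conv := integral_inner_convect_add_eq_zero (F' := EuclideanSpace ℝ (Fin 3)) hu1 hu1 hw1 hwc
  have hconv3 : ∫ x, VectorCalculus.divergence u x * ⟪u x, w x⟫ = 0 := by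
    rw [← integral_zero (α := EuclideanSpace ℝ (Fin 3)) (G := ℝ)]
    refine integral_congr_ae (Eventually.of_forall fun x => ?_)
    show VectorCalculus.divergence u x * ⟪u x, w x⟫ = 0
    by_cases hx : x ∈ tsupport φ
    · rw [hdiv x hx, zero_mul]
    · rw [hw0 x hx, inner_zero_right, mul_zero]
  have hconv2 : ∀ x, ⟪u x, convect u w x⟫ =
      φ x * ⟪convect u u x, u x⟫ + fderiv ℝ φ x (u x) * ‖u x‖ ^ 2 := fun x => by
    rw [hw, convect_smul_apply (hφd x) (hud x), inner_add_right, real_inner_smul_right,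
      real_inner_smul_right, real_inner_self_eq_norm_sq, real_inner_comm]
  have hconv1 : ∀ x, ⟪convect u u x, w x⟫ = φ x * ⟪convect u u x, u x⟫ := fun x => by
    rw [hw, real_inner_smul_right]
  -- integrability of all the integrands (continuous, compactly supported)
  have hcs_φ : ∀ f : EuclideanSpace ℝ (Fin 3) → ℝ, HasCompactSupport fun x => φ x * f x :=
    fun f => hφc.mul_right
  have hI_A : Integrable (fun x => φ x * ⟪convect u u x, u x⟫) :=
    (hφcn.mul ((hDuc.clm_apply huc).inner huc)).integrable_of_hasCompactSupport (hcs_φ _)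
  have hI_P : Integrable (fun x => φ x * ⟪convect u u x - (Δ u) x, u x⟫) :=
    (hφcn.mul (((hDuc.clm_apply huc).sub hΔuc).inner huc)).integrable_of_hasCompactSupport
      (hcs_φ _)
  have hFc : Continuous fun x => frobeniusNormSq (fderiv ℝ u x) := by
    rw [show (fun x => frobeniusNormSq (fderiv ℝ u x)) =
      fun x => ∑ i, ‖fderiv ℝ u x (b i)‖ ^ 2 from funext fun x => frobeniusNormSq_eq_sum b _]
    exact continuous_finsetSum _ fun i _ => ((hDuc.clm_apply continuous_const).norm).pow 2
  have hI_F : Integrable (fun x => φ x * frobeniusNormSq (fderiv ℝ u x)) :=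
    (hφcn.mul hFc).integrable_of_hasCompactSupport (hcs_φ _)
  have hcs_D : ∀ (v : EuclideanSpace ℝ (Fin 3) → EuclideanSpace ℝ (Fin 3))
      (f : EuclideanSpace ℝ (Fin 3) → ℝ),
      HasCompactSupport fun x => fderiv ℝ φ x (v x) * f x := fun v f =>
    hDφcs.mono fun x hx => by
      rw [mem_support] at hx ⊢
      contrapose! hx
      simp [hx]
  have hI_S : ∀ i, Integrable (fun x => fderiv ℝ φ x (b i) * ⟪fderiv ℝ u x (b i), u x⟫) :=
    fun i => (((hDφc.clm_apply continuous_const).mul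
      ((hDuc.clm_apply continuous_const).inner huc))).integrable_of_hasCompactSupport
        (hcs_D (fun _ => b i) _)
  have hI_T : Integrable (fun x => fderiv ℝ φ x (u x) * ‖u x‖ ^ 2) :=
    (((hDφc.clm_apply huc).mul (huc.norm.pow 2))).integrable_of_hasCompactSupport (hcs_D u _)
  -- assemble: rewrite every pairing
  have e1 : ∫ x, ⟪(Δ u) x, w x⟫ = (∫ x, φ x * ⟪convect u u x, u x⟫) -
      ∫ x, φ x * ⟪convect u u x - (Δ u) x, u x⟫ := by
    rw [← integral_sub hI_A hI_P]
    exact integral_congr_ae (Eventually.of_forall heq)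
  have e2 : ∑ i, ∫ x, ⟪fderiv ℝ u x (b i), fderiv ℝ w x (b i)⟫ =
      (∑ i, ∫ x, fderiv ℝ φ x (b i) * ⟪fderiv ℝ u x (b i), u x⟫) +
        ∫ x, φ x * frobeniusNormSq (fderiv ℝ u x) := by
    rw [← integral_finsetSum _ fun i _ => hI_S i, ← integral_add (integrable_finsetSum _
      fun i _ => hI_S i) hI_F]
    have : ∀ i, Integrable (fun x => ⟪fderiv ℝ u x (b i), fderiv ℝ w x (b i)⟫) := fun i => by
      have : (fun x => ⟪fderiv ℝ u x (b i), fderiv ℝ w x (b i)⟫) = fun x =>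
          fderiv ℝ φ x (b i) * ⟪fderiv ℝ u x (b i), u x⟫ + φ x * ‖fderiv ℝ u x (b i)‖ ^ 2 := by
        funext x
        rw [hDw x (b i), inner_add_right, real_inner_smul_right, real_inner_smul_right,
          real_inner_self_eq_norm_sq]
      rw [this]
      exact (hI_S i).add (((hφcn.mul ((hDuc.clm_apply continuous_const).norm.pow 2)))
        |>.integrable_of_hasCompactSupport (hcs_φ _))
    rw [← integral_finsetSum _ fun i _ => this i]
    exact integral_congr_ae (Eventually.of_forall fun x => hpair x)
  have e3 : ∑ i, ∫ x, ⟪fderiv ℝ φ x (b i), fderiv ℝ g x (b i)⟫ =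
      2 * ∑ i, ∫ x, fderiv ℝ φ x (b i) * ⟪fderiv ℝ u x (b i), u x⟫ := by
    rw [Finset.mul_sum]
    exact Finset.sum_congr rfl fun i _ => hg2b i
  have e4 : ∫ x, ⟪u x, convect u w x⟫ = (∫ x, φ x * ⟪convect u u x, u x⟫) +
      ∫ x, fderiv ℝ φ x (u x) * ‖u x‖ ^ 2 := by
    rw [← integral_add hI_A hI_T]
    exact integral_congr_ae (Eventually.of_forall hconv2)
  have e5 : ∫ x, ⟪convect u u x, w x⟫ = ∫ x, φ x * ⟪convect u u x, u x⟫ :=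
    integral_congr_ae (Eventually.of_forall hconv1)
  rw [e1, e2] at green1
  rw [hg2a, e3] at green2
  rw [e5, e4, hconv3] at conv
  linarith

end Steady

/-! ## §B. The continued field on `Q = (-1, T₀) × B_ρ(x₀)` satisfies the hypotheses of
Lemarié-Rieusset's Theorem 14.4

Setting of this section: `(u, p)` is a local Leray solution on the slab `(0, T') × ℝ³` with
measurable datum `u₀`; `G` is a weak spatial gradient of `u` on the slab with finite `L²` norms on
the boxes `(0,T') × B_R(y)`; `e ∈ C²(ℝ³; ℝ³)` agrees with `u₀` and is divergence free on the ball
`B_ρ(x₀)`; `0 < T₀ ≤ T'`. The continued objects `ū, p̄, f̄, Ḡ` are any fields equal to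
`e, 0, f₀ = (e·∇)e - Δe, De` at times `t ≤ 0` and to `u, p, 0, G` at times `t > 0` (hypotheses
`hu₁/hu₂`, …, in the style of `LocalEnergyConcat.concat`). -/

section Continuation

variable {x₀ : EuclideanSpace ℝ (Fin 3)} {ρ T' T₀ : ℝ}
  {u₀ e : EuclideanSpace ℝ (Fin 3) → EuclideanSpace ℝ (Fin 3)}
  {u uc fc : ℝ → EuclideanSpace ℝ (Fin 3) → EuclideanSpace ℝ (Fin 3)}
  {p pc : ℝ → EuclideanSpace ℝ (Fin 3) → ℝ}
  {G Gc : ℝ → EuclideanSpace ℝ (Fin 3) → EuclideanSpace ℝ (Fin 3) →L[ℝ] EuclideanSpace ℝ (Fin 3)}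

-- The space–time region `Q = (-1, T₀) × B_ρ(x₀)` of the continuation, as an open set.
set_option hygiene false in
local notation "𝒬" => (TopologicalSpace.Opens.mk (Ioo (-1 : ℝ) T₀ ×ˢ ball x₀ ρ)
  (isOpen_Ioo.prod isOpen_ball) : Opens (ℝ × EuclideanSpace ℝ (Fin 3)))

/-- The underlying set of `Q`. [folklore] -/
theorem coe_Q : ((𝒬 : Opens (ℝ × EuclideanSpace ℝ (Fin 3))) : Set (ℝ × EuclideanSpace ℝ (Fin 3))) =
    Ioo (-1 : ℝ) T₀ ×ˢ ball x₀ ρ := rfl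

/-- **`Q` is connected** (a product of an interval and a ball, both convex and nonempty for
`T₀ > 0`, `ρ > 0`). [folklore] -/
theorem isConnected_Q (hT₀ : 0 < T₀) (hρ : 0 < ρ) :
    IsConnected ((𝒬 : Opens (ℝ × EuclideanSpace ℝ (Fin 3))) : Set (ℝ × EuclideanSpace ℝ (Fin 3))) := by
  rw [coe_Q]
  have h1 : IsConnected (Ioo (-1 : ℝ) T₀) := isConnected_Ioo (by linarith)
  have h2 : IsConnected (ball x₀ ρ) := ⟨⟨x₀, mem_ball_self hρ⟩, (convex_ball x₀ ρ).isPreconnected⟩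
  exact h1.prod h2

/-- The lower half of `Q`: `Q ∩ {t < 0} = (-1, 0) × B_ρ(x₀)` (for `T₀ ≥ 0`). [folklore] -/
theorem Q_inter_fst_lt (hT₀ : 0 ≤ T₀) :
    (Ioo (-1 : ℝ) T₀ ×ˢ ball x₀ ρ) ∩ {z : ℝ × EuclideanSpace ℝ (Fin 3) | z.1 < 0} =
      Ioo (-1 : ℝ) 0 ×ˢ ball x₀ ρ := by
  rw [prod_inter_fst_lt]
  congr 1
  ext t; simp only [mem_inter_iff, mem_Ioo, mem_Iio]
  constructor
  · rintro ⟨⟨h1, -⟩, h2⟩; exact ⟨h1, h2⟩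
  · rintro ⟨h1, h2⟩; exact ⟨⟨h1, by linarith⟩, h2⟩

/-- The upper half of `Q`: `Q ∩ {0 < t} = (0, T₀) × B_ρ(x₀)`. [folklore] -/
theorem Q_inter_lt_fst :
    (Ioo (-1 : ℝ) T₀ ×ˢ ball x₀ ρ) ∩ {z : ℝ × EuclideanSpace ℝ (Fin 3) | 0 < z.1} =
      Ioo (0 : ℝ) T₀ ×ˢ ball x₀ ρ := by
  rw [prod_inter_lt_fst]
  congr 1
  ext t; simp only [mem_inter_iff, mem_Ioo, mem_Ioi]
  constructor
  · rintro ⟨⟨-, h1⟩, h2⟩; exact ⟨h2, h1⟩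
  · rintro ⟨h1, h2⟩; exact ⟨⟨by linarith, h2⟩, h1⟩

/-- `Q` has finite measure. [folklore] -/
theorem volume_Q_lt_top :
    volume (Ioo (-1 : ℝ) T₀ ×ˢ ball x₀ ρ) < ⊤ := by
  rw [Measure.volume_eq_prod, Measure.prod_prod]
  exact ENNReal.mul_lt_top measure_Ioo_lt_top measure_ball_lt_top

/-- **The continued velocity is in `L^∞_t L²_x(Q)`**: `∫_{Q_t} |ū(t)|² ≤ C` for a.e. `t`, with
`C` the larger of `A₀² |B_ρ|` (slices of the steady field, `|e| ≤ A₀` on the ball) and the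
uniformly local energy bound of the Leray solution at radius `ρ` (clause (2) of the class).
[folklore] -/
theorem exists_energyClass_Q (h : IsLocalLeraySolutionOn T' 1 u₀ u p) (hT₀T : T₀ ≤ T') (hρ : 0 < ρ)
    {A₀ : ℝ≥0} (hA₀ : ∀ x ∈ ball x₀ ρ, ‖e x‖ ≤ A₀)
    (hu₁ : ∀ t, t ≤ 0 → uc t = e) (hu₂ : ∀ t, 0 < t → uc t = u t) :
    ∃ C : ℝ≥0, ∀ᵐ t : ℝ, ∫⁻ x, ((𝒬 : Opens (ℝ × EuclideanSpace ℝ (Fin 3))) :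
        Set (ℝ × EuclideanSpace ℝ (Fin 3))).indicator
      (fun z : ℝ × EuclideanSpace ℝ (Fin 3) => ‖uc z.1 z.2‖ₑ ^ 2) (t, x) ≤ C := by
  obtain ⟨C₁, hC₁⟩ := h.uniformLocalEnergy ρ hρ
  set V : ℝ≥0 := (volume (ball x₀ ρ)).toNNReal with hV
  have hVe : (V : ℝ≥0∞) = volume (ball x₀ ρ) := ENNReal.coe_toNNReal measure_ball_lt_top.ne
  refine ⟨max C₁ (A₀ ^ 2 * V), ?_⟩
  have hC₁' := (ae_restrict_iff' (measurableSet_Ioo : MeasurableSet (Ioo (0 : ℝ) T'))).1 hC₁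
  filter_upwards [hC₁'] with t ht
  rw [coe_Q]
  by_cases htI : t ∈ Ioo (-1 : ℝ) T₀
  · -- inside the time window the indicator is that of the ball
    have e1 : (fun x => (Ioo (-1 : ℝ) T₀ ×ˢ ball x₀ ρ).indicator
        (fun z : ℝ × EuclideanSpace ℝ (Fin 3) => ‖uc z.1 z.2‖ₑ ^ 2) (t, x)) =
        (ball x₀ ρ).indicator fun x => ‖uc t x‖ₑ ^ 2 := by
      funext x
      by_cases hx : x ∈ ball x₀ ρ
      · rw [indicator_of_mem (mk_mem_prod htI hx), indicator_of_mem hx]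
      · rw [indicator_of_notMem (fun h' => hx h'.2), indicator_of_notMem hx]
    rw [e1, lintegral_indicator measurableSet_ball]
    rcases le_or_gt t 0 with ht0 | ht0
    · -- steady slice
      rw [hu₁ t ht0]
      calc ∫⁻ x in ball x₀ ρ, ‖e x‖ₑ ^ 2 ≤ ∫⁻ x in ball x₀ ρ, ((A₀ : ℝ≥0) : ℝ≥0∞) ^ 2 := by
            refine setLIntegral_mono measurable_const fun x hx => ?_
            have h1 : ‖e x‖ₑ ≤ ((A₀ : ℝ≥0) : ℝ≥0∞) := by
              rw [← ofReal_norm, ← ENNReal.ofReal_coe_nnreal]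
              exact ENNReal.ofReal_le_ofReal (hA₀ x hx)
            gcongr
        _ = ((A₀ ^ 2 * V : ℝ≥0) : ℝ≥0∞) := by
            rw [setLIntegral_const, ENNReal.coe_mul, ENNReal.coe_pow, hVe]
        _ ≤ ((max C₁ (A₀ ^ 2 * V) : ℝ≥0) : ℝ≥0∞) := by
            exact_mod_cast le_max_right _ _
    · -- Leray slice
      rw [hu₂ t ht0]
      have htT : t ∈ Ioo (0 : ℝ) T' := ⟨ht0, htI.2.trans_le hT₀T⟩
      calc ∫⁻ x in ball x₀ ρ, ‖u t x‖ₑ ^ 2 ≤ C₁ := ht htT x₀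
        _ ≤ ((max C₁ (A₀ ^ 2 * V) : ℝ≥0) : ℝ≥0∞) := by exact_mod_cast le_max_left _ _
  · -- outside the time window the indicator vanishes
    have e1 : (fun x => (Ioo (-1 : ℝ) T₀ ×ˢ ball x₀ ρ).indicator
        (fun z : ℝ × EuclideanSpace ℝ (Fin 3) => ‖uc z.1 z.2‖ₑ ^ 2) (t, x)) = fun _ => 0 := by
      funext x
      exact indicator_of_notMem (fun h' => htI h'.1) _
    rw [e1, lintegral_zero]
    exact bot_le

/-! ### Integrability of the continued fields on `Q` -/

/-- A continuous function on `ℝ³` is integrable on the lower half `(-1, 0) × B_ρ(x₀)` of `Q`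
(bounded on the closed ball, finite measure). [folklore] -/
theorem integrableOn_steady_lower {F : Type*} [NormedAddCommGroup F] {g : EuclideanSpace ℝ (Fin 3) → F}
    (hg : Continuous g) :
    IntegrableOn (fun z : ℝ × EuclideanSpace ℝ (Fin 3) => g z.2) (Ioo (-1 : ℝ) 0 ×ˢ ball x₀ ρ)
      volume := by
  obtain ⟨M, hM⟩ := (isCompact_closedBall x₀ ρ).exists_bound_of_continuousOn hg.continuousOn
  have hfin : volume (Ioo (-1 : ℝ) 0 ×ˢ ball x₀ ρ) ≠ ⊤ := by
    rw [Measure.volume_eq_prod, Measure.prod_prod]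
    exact (ENNReal.mul_lt_top measure_Ioo_lt_top measure_ball_lt_top).ne
  refine Measure.integrableOn_of_bounded hfin (hg.comp continuous_snd).aestronglyMeasurable
    (M := M) ?_
  filter_upwards [ae_restrict_mem (measurableSet_Ioo.prod measurableSet_ball)] with z hz
  exact hM z.2 (ball_subset_closedBall hz.2)

/-- **The continued velocity is integrable on `Q`** (steady half: continuous on a set of finite
measure; Leray half: `u ∈ L¹((0,T') × B̄_ρ)`). [folklore] -/
theorem integrableOn_uc (h : IsLocalLeraySolutionOn T' 1 u₀ u p) (hT₀ : 0 ≤ T₀) (hT₀T : T₀ ≤ T')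
    (he : ContDiff ℝ 1 e) (hu₁ : ∀ t, t ≤ 0 → uc t = e) (hu₂ : ∀ t, 0 < t → uc t = u t) :
    IntegrableOn (uncurry uc) (Ioo (-1 : ℝ) T₀ ×ˢ ball x₀ ρ) volume := by
  refine integrableOn_of_split (measurableSet_Ioo.prod measurableSet_ball) (t₀ := 0)
    (F₁ := fun z : ℝ × EuclideanSpace ℝ (Fin 3) => e z.2) (F₂ := uncurry u)
    (fun z hz => by simp only [uncurry, hu₁ z.1 hz.le]) (fun z hz => by simp only [uncurry, hu₂ z.1 hz])
    ?_ ?_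
  · rw [Q_inter_fst_lt hT₀]
    exact integrableOn_steady_lower he.continuous
  · rw [Q_inter_lt_fst]
    exact (h.integrableOn_velocity (isCompact_closedBall x₀ ρ)).1.mono_set
      (prod_mono (Ioo_subset_Ioo_right hT₀T) ball_subset_closedBall)

/-- **`|ū|²` is integrable on `Q`.** [folklore] -/
theorem integrableOn_uc_sq (h : IsLocalLeraySolutionOn T' 1 u₀ u p) (hT₀ : 0 ≤ T₀) (hT₀T : T₀ ≤ T')
    (he : ContDiff ℝ 1 e) (hu₁ : ∀ t, t ≤ 0 → uc t = e) (hu₂ : ∀ t, 0 < t → uc t = u t) :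
    IntegrableOn (fun z : ℝ × EuclideanSpace ℝ (Fin 3) => ‖uncurry uc z‖ ^ 2)
      (Ioo (-1 : ℝ) T₀ ×ˢ ball x₀ ρ) volume := by
  refine integrableOn_of_split (measurableSet_Ioo.prod measurableSet_ball) (t₀ := 0)
    (F₁ := fun z : ℝ × EuclideanSpace ℝ (Fin 3) => ‖e z.2‖ ^ 2)
    (F₂ := fun z : ℝ × EuclideanSpace ℝ (Fin 3) => ‖uncurry u z‖ ^ 2)
    (fun z hz => by simp only [uncurry, hu₁ z.1 hz.le]) (fun z hz => by simp only [uncurry, hu₂ z.1 hz])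
    ?_ ?_
  · rw [Q_inter_fst_lt hT₀]
    exact integrableOn_steady_lower (he.continuous.norm.pow 2)
  · rw [Q_inter_lt_fst]
    exact (h.integrableOn_velocity (isCompact_closedBall x₀ ρ)).2.mono_set
      (prod_mono (Ioo_subset_Ioo_right hT₀T) ball_subset_closedBall)

/-- **The continued pressure is integrable on `Q`.** [folklore] -/
theorem integrableOn_pc (h : IsLocalLeraySolutionOn T' 1 u₀ u p) (hT₀T : T₀ ≤ T')
    (hp₁ : ∀ t, t ≤ 0 → pc t = 0) (hp₂ : ∀ t, 0 < t → pc t = p t) :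
    IntegrableOn (uncurry pc) (Ioo (-1 : ℝ) T₀ ×ˢ ball x₀ ρ) volume := by
  refine integrableOn_of_split (measurableSet_Ioo.prod measurableSet_ball) (t₀ := 0)
    (F₁ := fun _ : ℝ × EuclideanSpace ℝ (Fin 3) => (0 : ℝ)) (F₂ := uncurry p)
    (fun z hz => by simp only [uncurry, hp₁ z.1 hz.le, Pi.zero_apply])
    (fun z hz => by simp only [uncurry, hp₂ z.1 hz])
    integrableOn_zero ?_
  rw [Q_inter_lt_fst]
  exact (h.integrableOn_pressure (isCompact_closedBall x₀ ρ)).mono_set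
    (prod_mono (Ioo_subset_Ioo_right hT₀T) ball_subset_closedBall)

/-- **The continued gradient is integrable on `Q`** (steady half: `De` continuous; Leray half:
`G ∈ L¹((0,T') × B̄_ρ)` by the box bounds, `integrableOn_grad_cylinder`). [folklore] -/
theorem integrableOn_Gc (hT₀ : 0 ≤ T₀) (hT₀T : T₀ ≤ T') (he : ContDiff ℝ 1 e)
    (hG : HasWeakSpatialGradientOn (slab (EuclideanSpace ℝ (Fin 3)) (Ioo 0 T') isOpen_Ioo) u G)
    (hGb : ∀ R : ℝ, 0 < R → ∃ C : ℝ≥0, ∀ y : EuclideanSpace ℝ (Fin 3),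
      ∫⁻ z in Ioo 0 T' ×ˢ ball y R, ENNReal.ofReal (frobeniusNormSq (G z.1 z.2)) ≤ C)
    (hG₁ : ∀ t, t ≤ 0 → Gc t = fderiv ℝ e) (hG₂ : ∀ t, 0 < t → Gc t = G t) :
    IntegrableOn (uncurry Gc) (Ioo (-1 : ℝ) T₀ ×ˢ ball x₀ ρ) volume := by
  refine integrableOn_of_split (measurableSet_Ioo.prod measurableSet_ball) (t₀ := 0)
    (F₁ := fun z : ℝ × EuclideanSpace ℝ (Fin 3) => fderiv ℝ e z.2) (F₂ := uncurry G)
    (fun z hz => by simp only [uncurry, hG₁ z.1 hz.le]) (fun z hz => by simp only [uncurry, hG₂ z.1 hz])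
    ?_ ?_
  · rw [Q_inter_fst_lt hT₀]
    exact integrableOn_steady_lower (he.continuous_fderiv one_ne_zero)
  · rw [Q_inter_lt_fst]
    exact (integrableOn_grad_cylinder hG hGb (isCompact_closedBall x₀ ρ)).mono_set
      (prod_mono (Ioo_subset_Ioo_right hT₀T) ball_subset_closedBall)

/-- **`∇ū ∈ L²(Q)`**: `∫∫_Q |Ḡ|² < ∞` (steady half: `|De|²` bounded on the ball; Leray half: the box
bound at radius `ρ`). [folklore] -/
theorem lintegral_Gc_sq_lt_top (hT₀ : 0 ≤ T₀) (hT₀T : T₀ ≤ T') (hρ : 0 < ρ) (he : ContDiff ℝ 1 e)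
    (hGb : ∀ R : ℝ, 0 < R → ∃ C : ℝ≥0, ∀ y : EuclideanSpace ℝ (Fin 3),
      ∫⁻ z in Ioo 0 T' ×ˢ ball y R, ENNReal.ofReal (frobeniusNormSq (G z.1 z.2)) ≤ C)
    (hG₁ : ∀ t, t ≤ 0 → Gc t = fderiv ℝ e) (hG₂ : ∀ t, 0 < t → Gc t = G t) :
    ∫⁻ z in Ioo (-1 : ℝ) T₀ ×ˢ ball x₀ ρ, ENNReal.ofReal (frobeniusNormSq (Gc z.1 z.2)) < ⊤ := by
  refine lt_of_le_of_lt (setLIntegral_split_le (measurableSet_Ioo.prod measurableSet_ball) (t₀ := 0)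
    (f₁ := fun z : ℝ × EuclideanSpace ℝ (Fin 3) => ENNReal.ofReal (frobeniusNormSq (fderiv ℝ e z.2)))
    (f₂ := fun z : ℝ × EuclideanSpace ℝ (Fin 3) => ENNReal.ofReal (frobeniusNormSq (G z.1 z.2)))
    (fun z hz => by simp only [hG₁ z.1 hz.le]) (fun z hz => by simp only [hG₂ z.1 hz])) ?_
  rw [Q_inter_fst_lt hT₀, Q_inter_lt_fst]
  refine ENNReal.add_lt_top.2 ⟨?_, ?_⟩
  · -- the steady half
    have hc : Continuous fun x => frobeniusNormSq (fderiv ℝ e x) :=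
      LerayHopfProofs.continuous_frobeniusNormSq.comp (he.continuous_fderiv one_ne_zero)
    obtain ⟨M, hM⟩ := (isCompact_closedBall x₀ ρ).exists_bound_of_continuousOn hc.continuousOn
    calc ∫⁻ z in Ioo (-1 : ℝ) 0 ×ˢ ball x₀ ρ, ENNReal.ofReal (frobeniusNormSq (fderiv ℝ e z.2))
        ≤ ∫⁻ z in Ioo (-1 : ℝ) 0 ×ˢ ball x₀ ρ, ENNReal.ofReal M := by
          refine setLIntegral_mono measurable_const fun z hz => ENNReal.ofReal_le_ofReal ?_
          exact (le_abs_self _).trans ((Real.norm_eq_abs _).symm.le.trans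
            (hM z.2 (ball_subset_closedBall hz.2)))
      _ < ⊤ := by
          rw [setLIntegral_const, Measure.volume_eq_prod, Measure.prod_prod]
          exact ENNReal.mul_lt_top ENNReal.ofReal_lt_top
            (ENNReal.mul_lt_top measure_Ioo_lt_top measure_ball_lt_top)
  · obtain ⟨C, hC⟩ := hGb ρ hρ
    exact lt_of_le_of_lt ((lintegral_mono_set (prod_mono (Ioo_subset_Ioo_right hT₀T) Subset.rfl)).trans
      (hC x₀)) ENNReal.coe_lt_top

/-- **`p̄ ∈ L^{3/2}(Q)`** (the steady half has zero pressure; the Leray half is clause (1) of the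
class on the compact cylinder `(0,T') × B̄_ρ`). [folklore] -/
theorem lintegral_pc_lt_top (h : IsLocalLeraySolutionOn T' 1 u₀ u p) (hT₀T : T₀ ≤ T')
    (hp₁ : ∀ t, t ≤ 0 → pc t = 0) (hp₂ : ∀ t, 0 < t → pc t = p t) :
    ∫⁻ z in Ioo (-1 : ℝ) T₀ ×ˢ ball x₀ ρ, ‖pc z.1 z.2‖ₑ ^ (3 / 2 : ℝ) < ⊤ := by
  refine lt_of_le_of_lt (setLIntegral_split_le (measurableSet_Ioo.prod measurableSet_ball) (t₀ := 0)
    (f₁ := fun _ : ℝ × EuclideanSpace ℝ (Fin 3) => (0 : ℝ≥0∞))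
    (f₂ := fun z : ℝ × EuclideanSpace ℝ (Fin 3) => ‖p z.1 z.2‖ₑ ^ (3 / 2 : ℝ))
    (fun z hz => by
      simp only [hp₁ z.1 hz.le, Pi.zero_apply, enorm_zero]
      exact ENNReal.zero_rpow_of_pos (by norm_num))
    (fun z hz => by simp only [hp₂ z.1 hz])) ?_
  rw [Q_inter_lt_fst, setLIntegral_const, zero_mul, zero_add]
  exact lt_of_le_of_lt (lintegral_mono_set (prod_mono (Ioo_subset_Ioo_right hT₀T) ball_subset_closedBall))
    (h.pressure _ (isCompact_closedBall x₀ ρ))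

/-- **The continued force is in `L³(Q)`**: it is the bounded function `f₀ = (e·∇)e - Δe` on the
steady half (`|f₀| ≤ F₀` on the ball) and `0` on the Leray half; `Q` has finite measure.
[folklore] -/
theorem memLp_fc (he : ContDiff ℝ 2 e) {F₀ : ℝ}
    (hF₀ : ∀ x ∈ ball x₀ ρ, ‖convect e e x - (Δ e) x‖ ≤ F₀)
    (hf₁ : ∀ t, t ≤ 0 → fc t = fun x => convect e e x - (Δ e) x) (hf₂ : ∀ t, 0 < t → fc t = 0) :
    MemLp (uncurry fc) (ENNReal.ofReal 3)
      (volume.restrict (Ioo (-1 : ℝ) T₀ ×ˢ ball x₀ ρ)) := by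
  -- the explicit formula for the continued force
  have hform : uncurry fc = {z : ℝ × EuclideanSpace ℝ (Fin 3) | z.1 ≤ 0}.indicator
      fun z => convect e e z.2 - (Δ e) z.2 := by
    funext z
    by_cases hz : z.1 ≤ 0
    · rw [indicator_of_mem (show z ∈ {z : ℝ × EuclideanSpace ℝ (Fin 3) | z.1 ≤ 0} from hz)]
      simp only [uncurry, hf₁ z.1 hz]
    · rw [indicator_of_notMem (show z ∉ {z : ℝ × EuclideanSpace ℝ (Fin 3) | z.1 ≤ 0} from hz)]
      simp only [uncurry, hf₂ z.1 (not_le.1 hz), Pi.zero_apply]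
  have hcont : Continuous fun z : ℝ × EuclideanSpace ℝ (Fin 3) => convect e e z.2 - (Δ e) z.2 := by
    have h1 : Continuous fun x => convect e e x - (Δ e) x :=
      (((he.continuous_fderiv (by norm_num)).clm_apply he.continuous)).sub (continuous_laplacian he)
    exact h1.comp continuous_snd
  have hmeas : AEStronglyMeasurable (uncurry fc)
      (volume.restrict (Ioo (-1 : ℝ) T₀ ×ˢ ball x₀ ρ)) := by
    rw [hform]
    exact (hcont.aestronglyMeasurable.indicator (measurableSet_fst_le 0)).restrict
  haveI : IsFiniteMeasure (volume.restrict (Ioo (-1 : ℝ) T₀ ×ˢ ball x₀ ρ)) :=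
    isFiniteMeasure_restrict.2 volume_Q_lt_top.ne
  refine MemLp.of_bound hmeas (max F₀ 0) ?_
  filter_upwards [ae_restrict_mem (measurableSet_Ioo.prod measurableSet_ball)] with z hz
  rw [hform]
  by_cases hz0 : z.1 ≤ 0
  · rw [indicator_of_mem (show z ∈ {z : ℝ × EuclideanSpace ℝ (Fin 3) | z.1 ≤ 0} from hz0)]
    exact (hF₀ z.2 hz.2).trans (le_max_left _ _)
  · rw [indicator_of_notMem (show z ∉ {z : ℝ × EuclideanSpace ℝ (Fin 3) | z.1 ≤ 0} from hz0), norm_zero]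
    exact le_max_right _ _

/-! ### The continued weak spatial gradient -/

/-- **`Ḡ` is a weak spatial gradient of `ū` on `Q`**: the integration by parts is in `x` only;
for `t ≤ 0` it is the classical one for the `C¹` field `e`, for a.e. `t ∈ (0, T')` the slice `G(t)`
is a weak derivative of the slice `u(t)` (`HasWeakSpatialGradientOn.ae_hasWeakFDerivOn_slice_slab`),
and for `t ≥ T'` the test function vanishes. [folklore] -/
theorem hasWeakSpatialGradientOn_Q (h : IsLocalLeraySolutionOn T' 1 u₀ u p) (hT₀ : 0 ≤ T₀)
    (hT₀T : T₀ ≤ T') (he : ContDiff ℝ 1 e)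
    (hG : HasWeakSpatialGradientOn (slab (EuclideanSpace ℝ (Fin 3)) (Ioo 0 T') isOpen_Ioo) u G)
    (hGb : ∀ R : ℝ, 0 < R → ∃ C : ℝ≥0, ∀ y : EuclideanSpace ℝ (Fin 3),
      ∫⁻ z in Ioo 0 T' ×ˢ ball y R, ENNReal.ofReal (frobeniusNormSq (G z.1 z.2)) ≤ C)
    (hu₁ : ∀ t, t ≤ 0 → uc t = e) (hu₂ : ∀ t, 0 < t → uc t = u t)
    (hG₁ : ∀ t, t ≤ 0 → Gc t = fderiv ℝ e) (hG₂ : ∀ t, 0 < t → Gc t = G t) :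
    HasWeakSpatialGradientOn (𝒬 : Opens (ℝ × EuclideanSpace ℝ (Fin 3))) uc Gc where
  locallyIntegrableOn := (integrableOn_uc h hT₀ hT₀T he hu₁ hu₂).locallyIntegrableOn
  locallyIntegrableOn_grad := (integrableOn_Gc hT₀ hT₀T he hG hGb hG₁ hG₂).locallyIntegrableOn
  integral_fderiv_mul_inner_eq φ hφ v w := by
    have hφtop : IsSpaceTimeTestOn (⊤ : Opens (ℝ × EuclideanSpace ℝ (Fin 3))) φ := hφ.mono le_top
    have hslice := (ae_restrict_iff' (measurableSet_Ioo : MeasurableSet (Ioo (0 : ℝ) T'))).1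
      hG.ae_hasWeakFDerivOn_slice_slab
    rw [← integral_neg]
    refine integral_congr_ae ?_
    filter_upwards [hslice] with t ht
    rcases le_or_gt t 0 with ht0 | ht0
    · -- steady slice
      rw [hu₁ t ht0, hG₁ t ht0]
      exact steady_integral_fderiv_mul_inner he (isTestFunctionOn_slice' hφtop t) v w
    · by_cases htT : t < T'
      · -- good Leray slice
        rw [hu₂ t ht0, hG₂ t ht0]
        exact integral_fderiv_mul_inner_of_hasWeakFDerivOn (ht ⟨ht0, htT⟩)
          (isTestFunctionOn_slice' hφtop t) v w
      · -- beyond the slab the test function vanishes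
        have hφt : φ t = fun _ => 0 := by
          funext x
          refine hφ.apply_eq_zero ?_
          show (t, x) ∉ Ioo (-1 : ℝ) T₀ ×ˢ ball x₀ ρ
          exact fun hmem => htT (hmem.1.2.trans_le hT₀T)
        simp [hφt]

/-! ### Tools: strips, the lower half, slices of test functions -/

/-- `∫_{I × ℝ³} F = ∫_I ∫_{ℝ³} F(t, x) dx dt` for `F` integrable on the strip. [folklore] -/
theorem setIntegral_strip_eq_integral_integral {F' : Type*} [NormedAddCommGroup F'] [NormedSpace ℝ F']
    {I : Set ℝ} {F : ℝ × EuclideanSpace ℝ (Fin 3) → F'}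
    (hF : IntegrableOn F (I ×ˢ (univ : Set (EuclideanSpace ℝ (Fin 3)))) volume) :
    ∫ z in I ×ˢ (univ : Set (EuclideanSpace ℝ (Fin 3))), F z = ∫ t in I, ∫ x, F (t, x) := by
  have e : ((volume : Measure (ℝ × EuclideanSpace ℝ (Fin 3))).restrict (I ×ˢ (univ : Set (EuclideanSpace ℝ (Fin 3))))) =
      ((volume : Measure ℝ).restrict I).prod (volume : Measure (EuclideanSpace ℝ (Fin 3))) := by
    rw [Measure.volume_eq_prod, Measure.restrict_prod_eq_prod_univ]
  have hF' : Integrable F (((volume : Measure ℝ).restrict I).prod (volume : Measure (EuclideanSpace ℝ (Fin 3)))) := by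
    rw [← e]; exact hF
  rw [e]
  exact integral_prod F hF'

/-- A continuous function on `ℝ × ℝ³` is integrable on the lower half `(-1, 0) × B_ρ(x₀)` of `Q`
(bounded on the compact box `[-1, 0] × B̄_ρ(x₀)`, finite measure). [folklore] -/
theorem integrableOn_lower_of_continuous {F' : Type*} [NormedAddCommGroup F']
    {g : ℝ × EuclideanSpace ℝ (Fin 3) → F'} (hg : Continuous g) :
    IntegrableOn g (Ioo (-1 : ℝ) 0 ×ˢ ball x₀ ρ) volume := by
  obtain ⟨M, hM⟩ := ((isCompact_Icc : IsCompact (Icc (-1 : ℝ) 0)).prod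
    (isCompact_closedBall x₀ ρ)).exists_bound_of_continuousOn hg.continuousOn
  have hfin : volume (Ioo (-1 : ℝ) 0 ×ˢ ball x₀ ρ) ≠ ⊤ := by
    rw [Measure.volume_eq_prod, Measure.prod_prod]
    exact (ENNReal.mul_lt_top measure_Ioo_lt_top measure_ball_lt_top).ne
  refine Measure.integrableOn_of_bounded hfin hg.aestronglyMeasurable (M := M) ?_
  filter_upwards [ae_restrict_mem (measurableSet_Ioo.prod measurableSet_ball)] with z hz
  exact hM z ⟨Ioo_subset_Icc_self hz.1, ball_subset_closedBall hz.2⟩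

/-- Slices of a test function on `Q` are supported in the ball: `tsupport (ψ t) ⊆ B_ρ(x₀)`.
[folklore] -/
theorem tsupport_slice_subset_ball {F' : Type*} [NormedAddCommGroup F'] [NormedSpace ℝ F']
    {ψ : ℝ → EuclideanSpace ℝ (Fin 3) → F'}
    (hψ : IsSpaceTimeTestOn (𝒬 : Opens (ℝ × EuclideanSpace ℝ (Fin 3))) ψ) (t : ℝ) :
    tsupport (ψ t) ⊆ ball x₀ ρ := by
  intro x hx
  by_contra hxB
  have hz : ((t, x) : ℝ × EuclideanSpace ℝ (Fin 3)) ∉ tsupport (uncurry ψ) := fun h' => by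
    have := hψ.tsupport_subset h'
    exact hxB this.2
  exact (notMem_tsupport_slice (φ := ψ) (z := (t, x)) hz) hx

/-- A test function on `Q` vanishes, together with its time derivative and its spatial
derivative, at points off `Q`. [folklore] -/
theorem test_derivatives_eq_zero_of_notMem {F' : Type*} [NormedAddCommGroup F'] [NormedSpace ℝ F']
    {ψ : ℝ → EuclideanSpace ℝ (Fin 3) → F'}
    (hψ : IsSpaceTimeTestOn (𝒬 : Opens (ℝ × EuclideanSpace ℝ (Fin 3))) ψ) {t : ℝ}
    {x : EuclideanSpace ℝ (Fin 3)} (h : ((t, x) : ℝ × EuclideanSpace ℝ (Fin 3)) ∉ Ioo (-1 : ℝ) T₀ ×ˢ ball x₀ ρ) :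
    ψ t x = 0 ∧ timeDeriv ψ t x = 0 ∧ fderiv ℝ (ψ t) x = 0 := by
  have hz : ((t, x) : ℝ × EuclideanSpace ℝ (Fin 3)) ∉ tsupport (uncurry ψ) := fun h' =>
    h (hψ.tsupport_subset h')
  exact ⟨hψ.apply_eq_zero h, IsSpaceTimeTestOn.timeDeriv_eq_zero_of_notMem hz,
    IsSpaceTimeTestOn.fderiv_slice_eq_zero_of_notMem hz⟩

/-- **The weak-form integrand of the Leray solution is integrable on the slab up to `t = 0`**:
for a test field `ψ` on all of `ℝ × ℝ³`, `⟪u, ∂ₜψ⟫ + ⟪u, (u·∇)ψ⟫ + ν⟪u, Δψ⟫ + p div ψ` is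
integrable on `(0, T') × ℝ³` (the slab-class twin of `LocalEnergyConcat.integrableOn_weakForm`,
same proof). [folklore] -/
theorem integrableOn_weakForm_slab {ν : ℝ} (h : IsLocalLeraySolutionOn T' ν u₀ u p)
    {ψ : ℝ → EuclideanSpace ℝ (Fin 3) → EuclideanSpace ℝ (Fin 3)}
    (hψ : IsSpaceTimeTestOn (⊤ : Opens (ℝ × EuclideanSpace ℝ (Fin 3))) ψ) :
    IntegrableOn (fun z : ℝ × EuclideanSpace ℝ (Fin 3) => ⟪u z.1 z.2, timeDeriv ψ z.1 z.2⟫ +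
        ⟪u z.1 z.2, convect (u z.1) (ψ z.1) z.2⟫ + ν * ⟪u z.1 z.2, Δ (ψ z.1) z.2⟫ +
        p z.1 z.2 * VectorCalculus.divergence (ψ z.1) z.2)
      (Ioo 0 T' ×ˢ (univ : Set (EuclideanSpace ℝ (Fin 3)))) volume := by
  -- the compact `x`-shadow `K`
  obtain ⟨K₀, hK₀, hK₀t⟩ := hψ.exists_compact_slice_subset
  obtain ⟨r, hr⟩ := hK₀.isBounded.subset_closedBall (0 : EuclideanSpace ℝ (Fin 3))
  set K : Set (EuclideanSpace ℝ (Fin 3)) := closedBall 0 r with hKdef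
  have hK : IsCompact K := isCompact_closedBall _ _
  have hKt : ∀ t, tsupport (ψ t) ⊆ K := fun t => (hK₀t t).trans hr
  have hψ0 : ∀ t x, x ∉ K → ψ t x = 0 := fun t x hx =>
    image_eq_zero_of_notMem_tsupport fun h' => hx (hKt t h')
  have hψ'0 : ∀ t x, x ∉ K → timeDeriv ψ t x = 0 := fun t x hx =>
    timeDeriv_eq_zero_of_forall (fun s => hψ0 s x hx) t
  have hD0 : ∀ t x, x ∉ K → fderiv ℝ (ψ t) x = 0 := fun t x hx =>
    fderiv_of_notMem_tsupport ℝ fun h' => hx (hKt t h')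
  have hL0 : ∀ t x, x ∉ K → Δ (ψ t) x = 0 := fun t x hx =>
    laplacian_eq_zero_of_notMem_tsupport fun h' => hx (hKt t h')
  have hdiv0 : ∀ t x, x ∉ K → VectorCalculus.divergence (ψ t) x = 0 := fun t x hx => by
    simp [VectorCalculus.divergence, hD0 t x hx]
  -- continuity of the coefficient fields
  have cψ' : Continuous (uncurry (timeDeriv ψ)) := hψ.continuous_timeDeriv
  have cD : Continuous fun z : ℝ × EuclideanSpace ℝ (Fin 3) => fderiv ℝ (ψ z.1) z.2 := by
    have hh := ((hψ.isSmoothSpaceTimeOn univ).fderiv_slice uniqueDiffOn_univ).continuousOn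
    rw [univ_prod_univ, continuousOn_univ] at hh
    exact hh
  have cL : Continuous fun z : ℝ × EuclideanSpace ℝ (Fin 3) => Δ (ψ z.1) z.2 := by
    have hh := ((hψ.isSmoothSpaceTimeOn univ).laplacian uniqueDiffOn_univ).continuousOn
    rw [univ_prod_univ, continuousOn_univ] at hh
    exact hh
  obtain ⟨cdiv, -⟩ := hψ.continuous_divergence_field
  -- integrability of the four pieces on `μ = dt|_(0,T') ⊗ dx`
  obtain ⟨hUK1, hUK2⟩ := h.integrableOn_velocity hK
  have hpK := h.integrableOn_pressure hK
  have iA : Integrable (fun z : ℝ × EuclideanSpace ℝ (Fin 3) => ⟪uncurry u z, uncurry (timeDeriv ψ) z⟫)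
      (((volume : Measure ℝ).restrict (Ioo 0 T')).prod (volume : Measure (EuclideanSpace ℝ (Fin 3)))) :=
    integrable_slab_inner hK hUK1 cψ' hψ'0
  have iB : Integrable (fun z : ℝ × EuclideanSpace ℝ (Fin 3) => ⟪uncurry u z, (fderiv ℝ (ψ z.1) z.2) (uncurry u z)⟫)
      (((volume : Measure ℝ).restrict (Ioo 0 T')).prod (volume : Measure (EuclideanSpace ℝ (Fin 3)))) :=
    integrable_slab_inner_clm_apply hK hUK1 hUK2 cD hD0
  have iC : Integrable (fun z : ℝ × EuclideanSpace ℝ (Fin 3) => ⟪uncurry u z, Δ (ψ z.1) z.2⟫)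
      (((volume : Measure ℝ).restrict (Ioo 0 T')).prod (volume : Measure (EuclideanSpace ℝ (Fin 3)))) :=
    integrable_slab_inner hK hUK1 cL hL0
  have iP : Integrable (fun z : ℝ × EuclideanSpace ℝ (Fin 3) => uncurry p z * VectorCalculus.divergence (ψ z.1) z.2)
      (((volume : Measure ℝ).restrict (Ioo 0 T')).prod (volume : Measure (EuclideanSpace ℝ (Fin 3)))) :=
    BradshawTsai2019.integrable_slab_mul hK hpK cdiv hdiv0
  have iΦ := ((iA.add iB).add (iC.const_mul ν)).add iP
  rw [← volume_restrict_slab_eq] at iΦ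
  refine iΦ.congr (Eventually.of_forall fun z => ?_)
  simp only [uncurry, convect_apply, Pi.add_apply]

/-! ### The continued pair solves the forced equations in the sense of distributions -/

/-- **Every slice of the continued velocity is weakly divergence free**, hence so is `ū` on
`Q`: the slices of `e` because `div e = 0` on the ball containing the supports, a.e. slice of `u`
by the weak form with datum (`IsWeakNSSolutionOn`, third clause). [folklore] -/
theorem setIntegral_inner_gradient_Q_eq_zero (h : IsLocalLeraySolutionOn T' 1 u₀ u p)
    (hm₀ : AEStronglyMeasurable u₀ volume) (hT₀ : 0 ≤ T₀) (hT₀T : T₀ ≤ T')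
    (he : ContDiff ℝ 1 e) (hdiv : ∀ x ∈ ball x₀ ρ, VectorCalculus.divergence e x = 0)
    (hu₁ : ∀ t, t ≤ 0 → uc t = e) (hu₂ : ∀ t, 0 < t → uc t = u t)
    {θ : ℝ → EuclideanSpace ℝ (Fin 3) → ℝ}
    (hθ : IsSpaceTimeTestOn (𝒬 : Opens (ℝ × EuclideanSpace ℝ (Fin 3))) θ) :
    ∫ z in Ioo (-1 : ℝ) T₀ ×ˢ ball x₀ ρ, ⟪uc z.1 z.2, gradient (θ z.1) z.2⟫ = 0 := by
  have hθtop : IsSpaceTimeTestOn (⊤ : Opens (ℝ × EuclideanSpace ℝ (Fin 3))) θ := hθ.mono le_top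
  set F : ℝ × EuclideanSpace ℝ (Fin 3) → ℝ := fun z => ⟪uc z.1 z.2, gradient (θ z.1) z.2⟫ with hF
  -- (1) off `Q` the integrand vanishes
  have hF0 : ∀ z, z ∉ Ioo (-1 : ℝ) T₀ ×ˢ ball x₀ ρ → F z = 0 := fun z hz => by
    have h3 := (test_derivatives_eq_zero_of_notMem hθ (t := z.1) (x := z.2) hz).2.2
    simp only [hF, gradient, h3, map_zero, inner_zero_right]
  rw [setIntegral_eq_integral_of_forall_compl_eq_zero fun z hz => hF0 z hz]
  -- (2) integrability on `ℝ × ℝ³`, Fubini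
  obtain ⟨cg, hcgc, -⟩ := hθ.continuous_gradient_field
  have hI : Integrable F volume :=
    integrable_inner_of_locallyIntegrableOn
      ((integrableOn_uc h hT₀ hT₀T he hu₁ hu₂).locallyIntegrableOn) cg
      hθ.hasCompactSupport hθ.tsupport_subset fun z hz => by
        show gradient (θ z.1) z.2 = 0
        simp only [gradient, IsSpaceTimeTestOn.fderiv_slice_eq_zero_of_notMem hz, map_zero]
  rw [Measure.volume_eq_prod, integral_prod F (by rw [← Measure.volume_eq_prod]; exact hI)]
  -- (3) every good slice vanishes
  have hweak := h.distributional.isWeakNSSolutionOn_datum h.sqIntegrable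
    (fun K _ => integrableOn_zero) hm₀ h.initial
  have hdivae := (ae_restrict_iff' (measurableSet_Ioo : MeasurableSet (Ioo (0 : ℝ) T'))).1
    hweak.2.2.1
  rw [← integral_zero (α := ℝ) (G := ℝ)]
  refine integral_congr_ae ?_
  filter_upwards [hdivae] with t ht
  show ∫ x, F (t, x) = 0
  rcases le_or_gt t 0 with ht0 | ht0
  · -- steady slice
    simp only [hF, hu₁ t ht0]
    refine steady_integral_inner_gradient_eq_zero he ((hθtop.contDiff_slice t).of_le (by exact_mod_cast le_top))
      (hθtop.hasCompactSupport_slice t) fun x hx => hdiv x (tsupport_slice_subset_ball hθ t hx)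
  · by_cases htT : t < T'
    · -- good Leray slice
      simp only [hF, hu₂ t ht0]
      exact ht ⟨ht0, htT⟩ (θ t) (isTestFunctionOn_slice' hθtop t)
    · -- beyond the slab
      simp only [hF]
      rw [← integral_zero (α := EuclideanSpace ℝ (Fin 3)) (G := ℝ)]
      refine integral_congr_ae (Eventually.of_forall fun x => ?_)
      have hz : ((t, x) : ℝ × EuclideanSpace ℝ (Fin 3)) ∉ Ioo (-1 : ℝ) T₀ ×ˢ ball x₀ ρ :=
        fun hmem => htT (hmem.1.2.trans_le hT₀T)
      exact hF0 (t, x) hz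

/-- **The weak-form integrand of a test field on `Q` vanishes off `Q`** (every term carries a
derivative or a value of `ψ`). [folklore] -/
theorem weakForm_eq_zero_of_notMem {v : ℝ → EuclideanSpace ℝ (Fin 3) → EuclideanSpace ℝ (Fin 3)}
    {q : ℝ → EuclideanSpace ℝ (Fin 3) → ℝ} {g : ℝ → EuclideanSpace ℝ (Fin 3) → EuclideanSpace ℝ (Fin 3)} {ν : ℝ}
    {ψ : ℝ → EuclideanSpace ℝ (Fin 3) → EuclideanSpace ℝ (Fin 3)}
    (hψ : IsSpaceTimeTestOn (𝒬 : Opens (ℝ × EuclideanSpace ℝ (Fin 3))) ψ)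
    {z : ℝ × EuclideanSpace ℝ (Fin 3)} (hz : z ∉ Ioo (-1 : ℝ) T₀ ×ˢ ball x₀ ρ) :
    ⟪v z.1 z.2, timeDeriv ψ z.1 z.2⟫ + ⟪v z.1 z.2, convect (v z.1) (ψ z.1) z.2⟫ +
        ν * ⟪v z.1 z.2, Δ (ψ z.1) z.2⟫ + q z.1 z.2 * VectorCalculus.divergence (ψ z.1) z.2 +
        ⟪g z.1 z.2, ψ z.1 z.2⟫ = 0 := by
  obtain ⟨h1, h2, h3⟩ := test_derivatives_eq_zero_of_notMem hψ (t := z.1) (x := z.2) hz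
  have h4 := hψ.laplacian_slice_eq_zero (t := z.1) (x := z.2) hz
  have h5 : VectorCalculus.divergence (ψ z.1) z.2 = 0 := by
    simp [VectorCalculus.divergence, h3]
  simp only [h1, h2, convect_apply, h3, h4, h5, inner_zero_right, _root_.zero_apply,
    mul_zero, add_zero]

/-- **The continued pair solves the forced momentum equation in the sense of distributions on
`Q`.** For a test field `ψ` on `Q`, split `∫∫_Q (⟪ū, ∂ₜψ⟫ + ⟪ū, (ū·∇)ψ⟫ + ⟪ū, Δψ⟫ + p̄ div ψ +
⟪f̄, ψ⟫)` at `t = 0`: the upper part is the weak form of the Leray solution **with its datum**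
(`weakIdentity_datum_pressure_of_distributional`), equal to `-∫ ⟪u₀, ψ(0)⟫`; on the lower part
the steady identity `steady_integral_momentum_eq_zero` leaves `∫∫_{t<0} ⟪e, ∂ₜψ⟫ = ∫ ⟪e, ψ(0)⟫`
(fundamental theorem of calculus in `t`), and `e = u₀` on the support of `ψ(0)`.
[cite: JiaSverak2014, §3–§4 (extension of the perturbation across t = 0, arXiv pp. 7–9)] -/
theorem setIntegral_momentum_Q_eq_zero (h : IsLocalLeraySolutionOn T' 1 u₀ u p)
    (hm₀ : AEStronglyMeasurable u₀ volume) (hT₀ : 0 < T₀) (hT₀T : T₀ ≤ T')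
    (he : ContDiff ℝ 2 e) (heu : ∀ x ∈ ball x₀ ρ, e x = u₀ x)
    (hdiv : ∀ x ∈ ball x₀ ρ, VectorCalculus.divergence e x = 0)
    (hu₁ : ∀ t, t ≤ 0 → uc t = e) (hu₂ : ∀ t, 0 < t → uc t = u t)
    (hp₁ : ∀ t, t ≤ 0 → pc t = 0) (hp₂ : ∀ t, 0 < t → pc t = p t)
    (hf₁ : ∀ t, t ≤ 0 → fc t = fun x => convect e e x - (Δ e) x) (hf₂ : ∀ t, 0 < t → fc t = 0)
    {ψ : ℝ → EuclideanSpace ℝ (Fin 3) → EuclideanSpace ℝ (Fin 3)}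
    (hψ : IsSpaceTimeTestOn (𝒬 : Opens (ℝ × EuclideanSpace ℝ (Fin 3))) ψ) :
    ∫ z in Ioo (-1 : ℝ) T₀ ×ˢ ball x₀ ρ,
      (⟪uc z.1 z.2, timeDeriv ψ z.1 z.2⟫ + ⟪uc z.1 z.2, convect (uc z.1) (ψ z.1) z.2⟫ +
        1 * ⟪uc z.1 z.2, Δ (ψ z.1) z.2⟫ + pc z.1 z.2 * VectorCalculus.divergence (ψ z.1) z.2 +
        ⟪fc z.1 z.2, ψ z.1 z.2⟫) = 0 := by
  have hT : 0 < T' := hT₀.trans_le hT₀T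
  have hψtop : IsSpaceTimeTestOn (⊤ : Opens (ℝ × EuclideanSpace ℝ (Fin 3))) ψ := hψ.mono le_top
  have hψT : IsSpaceTimeTestOn (slab (EuclideanSpace ℝ (Fin 3)) (Iio T') isOpen_Iio) ψ :=
    hψ.mono fun z hz => mem_slab.2 (hz.1.2.trans_le hT₀T)
  have he1 : ContDiff ℝ 1 e := he.of_le one_le_two
  -- continuity of the test-field ingredients
  have cψ : Continuous (uncurry ψ) := hψ.contDiff.continuous
  have cψ' : Continuous (uncurry (timeDeriv ψ)) := hψ.continuous_timeDeriv
  have cD : Continuous fun z : ℝ × EuclideanSpace ℝ (Fin 3) => fderiv ℝ (ψ z.1) z.2 := by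
    have hh := ((hψ.isSmoothSpaceTimeOn univ).fderiv_slice uniqueDiffOn_univ).continuousOn
    rw [univ_prod_univ, continuousOn_univ] at hh
    exact hh
  have cL : Continuous fun z : ℝ × EuclideanSpace ℝ (Fin 3) => Δ (ψ z.1) z.2 := by
    have hh := ((hψ.isSmoothSpaceTimeOn univ).laplacian uniqueDiffOn_univ).continuousOn
    rw [univ_prod_univ, continuousOn_univ] at hh
    exact hh
  have cf₀ : Continuous fun x => convect e e x - (Δ e) x :=
    (((he.continuous_fderiv (by norm_num)).clm_apply he.continuous)).sub (continuous_laplacian he)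
  -- ## the two integrands
  set F₁ : ℝ × EuclideanSpace ℝ (Fin 3) → ℝ := fun z => ⟪e z.2, timeDeriv ψ z.1 z.2⟫ +
    (⟪e z.2, convect e (ψ z.1) z.2⟫ + ⟪e z.2, (Δ (ψ z.1)) z.2⟫ +
      ⟪convect e e z.2 - (Δ e) z.2, ψ z.1 z.2⟫) with hF₁
  set F₂ : ℝ × EuclideanSpace ℝ (Fin 3) → ℝ := fun z => ⟪u z.1 z.2, timeDeriv ψ z.1 z.2⟫ +
    ⟪u z.1 z.2, convect (u z.1) (ψ z.1) z.2⟫ + 1 * ⟪u z.1 z.2, Δ (ψ z.1) z.2⟫ +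
    p z.1 z.2 * VectorCalculus.divergence (ψ z.1) z.2 with hF₂
  have cF₁ : Continuous F₁ := by
    have ce : Continuous fun z : ℝ × EuclideanSpace ℝ (Fin 3) => e z.2 := he.continuous.comp continuous_snd
    refine (ce.inner cψ').add (((ce.inner (cD.clm_apply ce)).add (ce.inner cL)).add
      ((cf₀.comp continuous_snd).inner cψ))
  -- vanishing off `Q`
  have hF₁0 : ∀ z : ℝ × EuclideanSpace ℝ (Fin 3), z ∉ Ioo (-1 : ℝ) T₀ ×ˢ ball x₀ ρ → F₁ z = 0 := by
    intro z hz
    have := weakForm_eq_zero_of_notMem (v := fun _ => e) (q := fun _ _ => (0 : ℝ))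
      (g := fun _ x => convect e e x - (Δ e) x) (ν := 1) hψ hz
    simp only [hF₁]
    simp only [one_mul, zero_mul, add_zero] at this
    linarith
  have hF₂0 : ∀ z : ℝ × EuclideanSpace ℝ (Fin 3), z ∉ Ioo (-1 : ℝ) T₀ ×ˢ ball x₀ ρ → F₂ z = 0 := by
    intro z hz
    have := weakForm_eq_zero_of_notMem (v := u) (q := p)
      (g := fun _ _ => (0 : EuclideanSpace ℝ (Fin 3))) (ν := 1) hψ hz
    simp only [hF₂]
    simp only [inner_zero_left, add_zero] at this
    exact this
  -- ## split at `t = 0`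
  have hsplit := setIntegral_split (D := Ioo (-1 : ℝ) T₀ ×ˢ ball x₀ ρ)
    (measurableSet_Ioo.prod measurableSet_ball) (t₀ := (0 : ℝ))
    (F := fun z : ℝ × EuclideanSpace ℝ (Fin 3) =>
      ⟪uc z.1 z.2, timeDeriv ψ z.1 z.2⟫ + ⟪uc z.1 z.2, convect (uc z.1) (ψ z.1) z.2⟫ +
        1 * ⟪uc z.1 z.2, Δ (ψ z.1) z.2⟫ + pc z.1 z.2 * VectorCalculus.divergence (ψ z.1) z.2 +
        ⟪fc z.1 z.2, ψ z.1 z.2⟫)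
    (F₁ := F₁) (F₂ := F₂)
    (fun z hz => by
      simp only [hF₁, hu₁ z.1 hz.le, hp₁ z.1 hz.le, hf₁ z.1 hz.le, Pi.zero_apply, zero_mul, add_zero,
        one_mul]
      ring)
    (fun z hz => by
      simp only [hF₂, hu₂ z.1 hz, hp₂ z.1 hz, hf₂ z.1 hz, Pi.zero_apply, inner_zero_left, add_zero])
    (by rw [Q_inter_fst_lt hT₀.le]; exact integrableOn_lower_of_continuous cF₁)
    (by
      rw [Q_inter_lt_fst]
      exact (integrableOn_weakForm_slab h hψtop).mono_set
        (prod_mono (Ioo_subset_Ioo_right hT₀T) (subset_univ _)))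
  rw [hsplit, Q_inter_fst_lt hT₀.le, Q_inter_lt_fst]
  -- ## the upper half: the weak form of the Leray solution with its datum
  have hU : ∫ z in Ioo (0 : ℝ) T₀ ×ˢ ball x₀ ρ, F₂ z = -∫ x, ⟪u₀ x, ψ 0 x⟫ := by
    have e1 : ∫ z in Ioo (0 : ℝ) T₀ ×ˢ ball x₀ ρ, F₂ z =
        ∫ z in Ioo (0 : ℝ) T' ×ˢ (univ : Set (EuclideanSpace ℝ (Fin 3))), F₂ z := by
      refine (setIntegral_eq_of_subset_of_forall_sdiff_eq_zero (measurableSet_Ioo.prod MeasurableSet.univ)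
        (prod_mono (Ioo_subset_Ioo_right hT₀T) (subset_univ _)) fun z hz => hF₂0 z ?_).symm
      intro hzQ
      exact hz.2 ⟨⟨hz.1.1.1, hzQ.1.2⟩, hzQ.2⟩
    have e2 := setIntegral_slab_eq_integral_integral (integrableOn_weakForm_slab h hψtop)
    have hgood := ae_slice_aestronglyMeasurable_and_lintegral_ball_lt_top h.aestronglyMeasurable
      h.sqIntegrable
    have key := weakIdentity_datum_pressure_of_distributional hT
      (fun K hK => h.integrableOn_velocity hK)
      (fun φ hφ => h.distributional.2.2.2.2 φ hφ)
      (fun K _ => integrableOn_zero)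
      (fun K hK => h.integrableOn_pressure hK) hgood hm₀ h.initial hψT
    simp only [Pi.zero_apply, inner_zero_left, add_zero] at key
    rw [e1, e2]
    have e3 : (∫ t in Ioo 0 T', ∫ x, F₂ (t, x)) = ∫ t in Ioo 0 T', ∫ x,
        (⟪u t x, timeDeriv ψ t x⟫ + ⟪u t x, convect (u t) (ψ t) x⟫ + 1 * ⟪u t x, Δ (ψ t) x⟫ +
          p t x * VectorCalculus.divergence (ψ t) x) := rfl
    rw [e3]
    linarith
  -- ## the lower half: the steady identity and the fundamental theorem of calculus
  have hL : ∫ z in Ioo (-1 : ℝ) 0 ×ˢ ball x₀ ρ, F₁ z = ∫ x, ⟪u₀ x, ψ 0 x⟫ := by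
    -- (a) to the strip
    have e1 : ∫ z in Ioo (-1 : ℝ) 0 ×ˢ ball x₀ ρ, F₁ z =
        ∫ z in Ioo (-1 : ℝ) 0 ×ˢ (univ : Set (EuclideanSpace ℝ (Fin 3))), F₁ z := by
      refine (setIntegral_eq_of_subset_of_forall_sdiff_eq_zero (measurableSet_Ioo.prod MeasurableSet.univ)
        (prod_mono Subset.rfl (subset_univ _)) fun z hz => hF₁0 z ?_).symm
      intro hzQ
      exact hz.2 ⟨hz.1.1, hzQ.2⟩
    have hI₁ : IntegrableOn F₁ (Ioo (-1 : ℝ) 0 ×ˢ (univ : Set (EuclideanSpace ℝ (Fin 3)))) volume := by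
      refine (integrableOn_lower_of_continuous (x₀ := x₀) (ρ := ρ) cF₁).of_forall_sdiff_eq_zero
        (measurableSet_Ioo.prod MeasurableSet.univ) fun z hz => hF₁0 z ?_
      intro hzQ
      exact hz.2 ⟨hz.1.1, hzQ.2⟩
    rw [e1, setIntegral_strip_eq_integral_integral hI₁]
    -- (b) the slices: only the time-derivative term survives
    have hslice : ∀ t, ∫ x, F₁ (t, x) = ∫ x, ⟪e x, timeDeriv ψ t x⟫ := by
      intro t
      have hK : ∀ x, x ∉ closedBall x₀ ρ → ((t, x) : ℝ × EuclideanSpace ℝ (Fin 3)) ∉ Ioo (-1 : ℝ) T₀ ×ˢ ball x₀ ρ :=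
        fun x hx hmem => hx (ball_subset_closedBall hmem.2)
      have hst := steady_integral_momentum_eq_zero he ((hψtop.contDiff_slice t).of_le (by norm_cast))
        (hψtop.hasCompactSupport_slice t) fun x hx => hdiv x (tsupport_slice_subset_ball hψ t hx)
      have iT : Integrable (fun x => ⟪e x, timeDeriv ψ t x⟫) := by
        refine (he.continuous.inner (cψ'.comp (Continuous.prodMk_right t))).integrable_of_hasCompactSupport ?_
        refine HasCompactSupport.intro (isCompact_closedBall x₀ ρ) fun x hx => ?_
        have := (test_derivatives_eq_zero_of_notMem hψ (hK x hx)).2.1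
        simp only [this, inner_zero_right]
      have iR : Integrable (fun x => ⟪e x, convect e (ψ t) x⟫ + ⟪e x, (Δ (ψ t)) x⟫ +
          ⟪convect e e x - (Δ e) x, ψ t x⟫) := by
        refine Continuous.integrable_of_hasCompactSupport ?_ ?_
        · exact ((he.continuous.inner ((cD.comp (Continuous.prodMk_right t)).clm_apply he.continuous)).add
            (he.continuous.inner (cL.comp (Continuous.prodMk_right t)))).add
            (cf₀.inner (cψ.comp (Continuous.prodMk_right t)))
        · refine HasCompactSupport.intro (isCompact_closedBall x₀ ρ) fun x hx => ?_
          have h0 := weakForm_eq_zero_of_notMem (v := fun _ => e) (q := fun _ _ => (0 : ℝ))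
            (g := fun _ x => convect e e x - (Δ e) x) (ν := 1) hψ (hK x hx)
          have h1 := (test_derivatives_eq_zero_of_notMem hψ (hK x hx)).2.1
          simp only [h1, inner_zero_right, zero_add, one_mul, zero_mul, add_zero] at h0
          exact h0
      have e2 : ∫ x, F₁ (t, x) = (∫ x, ⟪e x, timeDeriv ψ t x⟫) + ∫ x, (⟪e x, convect e (ψ t) x⟫ +
          ⟪e x, (Δ (ψ t)) x⟫ + ⟪convect e e x - (Δ e) x, ψ t x⟫) := by
        rw [← integral_add iT iR]
      rw [e2, hst, add_zero]
    simp_rw [hslice]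
    -- (c) Fubini and the fundamental theorem of calculus in `t`
    have hH : Integrable (uncurry fun t x => ⟪e x, timeDeriv ψ t x⟫)
        (((volume : Measure ℝ).restrict (Ioo (-1 : ℝ) 0)).prod (volume : Measure (EuclideanSpace ℝ (Fin 3)))) := by
      have hc : Continuous (uncurry fun t x => ⟪e x, timeDeriv ψ t x⟫) :=
        (he.continuous.comp continuous_snd).inner cψ'
      have hcs : HasCompactSupport (uncurry fun t x => ⟪e x, timeDeriv ψ t x⟫) := by
        refine (hψtop.timeDeriv_top.hasCompactSupport).mono fun z hz => ?_
        contrapose! hz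
        simp only [mem_support, not_not] at hz
        simp only [mem_support, not_not, uncurry]
        show ⟪e z.2, timeDeriv ψ z.1 z.2⟫ = 0
        rw [show timeDeriv ψ z.1 z.2 = uncurry (timeDeriv ψ) z from rfl, hz, inner_zero_right]
      have hI : Integrable (uncurry fun t x => ⟪e x, timeDeriv ψ t x⟫)
          (volume : Measure (ℝ × EuclideanSpace ℝ (Fin 3))) := hc.integrable_of_hasCompactSupport hcs
      rw [Measure.volume_eq_prod] at hI
      exact hI.mono_measure (Measure.prod_mono Measure.restrict_le_self le_rfl)
    rw [integral_integral_swap hH]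
    refine integral_congr_ae (Eventually.of_forall fun x => ?_)
    show ∫ t in Ioo (-1 : ℝ) 0, ⟪e x, timeDeriv ψ t x⟫ = ⟪u₀ x, ψ 0 x⟫
    have hct : Continuous fun t => timeDeriv ψ t x := cψ'.comp (Continuous.prodMk_left x)
    have iτ : Integrable (fun t => timeDeriv ψ t x) ((volume : Measure ℝ).restrict (Ioo (-1 : ℝ) 0)) :=
      (hct.integrableOn_Icc).mono_set Ioo_subset_Icc_self
    rw [integral_inner iτ]
    have hFTC : ∫ t in Ioo (-1 : ℝ) 0, timeDeriv ψ t x = ψ 0 x - ψ (-1) x := by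
      rw [← integral_Ioc_eq_integral_Ioo, ← intervalIntegral.integral_of_le (by norm_num)]
      exact intervalIntegral.integral_eq_sub_of_hasDerivAt (fun t _ => hψtop.hasDerivAt_time t x)
        (hct.intervalIntegrable _ _)
    have hψm1 : ψ (-1) x = 0 := hψ.apply_eq_zero (fun hmem => by
      have : (-1 : ℝ) ∈ Ioo (-1 : ℝ) T₀ := hmem.1
      exact lt_irrefl _ this.1)
    rw [hFTC, hψm1, sub_zero]
    by_cases hx : x ∈ ball x₀ ρ
    · rw [heu x hx]
    · have : ψ 0 x = 0 := hψ.apply_eq_zero (fun hmem => hx hmem.2)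
      rw [this, inner_zero_right, inner_zero_right]
  rw [hL, hU, add_neg_cancel]

/-- **The continued pair solves the forced Navier–Stokes system in the sense of distributions
on `Q`** (force `f̄ = 1_{t<0} ((e·∇)e - Δe)`, viscosity `1`). [cite: JiaSverak2014, §3–§4 (arXiv pp. 7–9)] -/
theorem isDistributionalNSSolutionOn_Q (h : IsLocalLeraySolutionOn T' 1 u₀ u p)
    (hm₀ : AEStronglyMeasurable u₀ volume) (hT₀ : 0 < T₀) (hT₀T : T₀ ≤ T')
    (he : ContDiff ℝ 2 e) (heu : ∀ x ∈ ball x₀ ρ, e x = u₀ x)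
    (hdiv : ∀ x ∈ ball x₀ ρ, VectorCalculus.divergence e x = 0)
    (hu₁ : ∀ t, t ≤ 0 → uc t = e) (hu₂ : ∀ t, 0 < t → uc t = u t)
    (hp₁ : ∀ t, t ≤ 0 → pc t = 0) (hp₂ : ∀ t, 0 < t → pc t = p t)
    (hf₁ : ∀ t, t ≤ 0 → fc t = fun x => convect e e x - (Δ e) x) (hf₂ : ∀ t, 0 < t → fc t = 0) :
    IsDistributionalNSSolutionOn (𝒬 : Opens (ℝ × EuclideanSpace ℝ (Fin 3))) 1 fc uc pc := by
  have he1 : ContDiff ℝ 1 e := he.of_le one_le_two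
  exact ⟨(integrableOn_uc h hT₀.le hT₀T he1 hu₁ hu₂).locallyIntegrableOn,
    (integrableOn_uc_sq h hT₀.le hT₀T he1 hu₁ hu₂).locallyIntegrableOn,
    (integrableOn_pc h hT₀T hp₁ hp₂).locallyIntegrableOn,
    fun θ hθ => setIntegral_inner_gradient_Q_eq_zero h hm₀ hT₀.le hT₀T he1 hdiv hu₁ hu₂ hθ,
    fun ψ hψ => setIntegral_momentum_Q_eq_zero h hm₀ hT₀ hT₀T he heu hdiv hu₁ hu₂ hp₁ hp₂ hf₁ hf₂ hψ⟩

/-! ### The local energy inequality of the continued pair across `t = 0` -/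

/-- The local energy integrand of a test function on `Q` vanishes off `Q`. [folklore] -/
theorem localEnergyRHS_eq_zero_of_notMem {v g : ℝ → EuclideanSpace ℝ (Fin 3) → EuclideanSpace ℝ (Fin 3)}
    {q : ℝ → EuclideanSpace ℝ (Fin 3) → ℝ} {ν : ℝ} {φ : ℝ → EuclideanSpace ℝ (Fin 3) → ℝ}
    (hφ : IsSpaceTimeTestOn (𝒬 : Opens (ℝ × EuclideanSpace ℝ (Fin 3))) φ)
    {z : ℝ × EuclideanSpace ℝ (Fin 3)} (hz : z ∉ Ioo (-1 : ℝ) T₀ ×ˢ ball x₀ ρ) :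
    localEnergyRHS ν g v q φ z = 0 := by
  obtain ⟨h1, h2, h3⟩ := test_derivatives_eq_zero_of_notMem hφ (t := z.1) (x := z.2) hz
  have h4 := hφ.laplacian_slice_eq_zero (t := z.1) (x := z.2) hz
  have h5 : gradient (φ z.1) z.2 = 0 := by simp [gradient, h3]
  simp only [localEnergyRHS, h1, h2, h4, h5, inner_zero_right, mul_zero, add_zero]

/-- **The continued pair is suitable on `Q`**: for every nonnegative test function `φ` on `Q`,
`2 ∫∫ |Ḡ|² φ ≤ ∫∫ (|ū|²(φₜ + Δφ) + (|ū|² + 2p̄) ū·∇φ + 2 ⟪f̄, ū⟫ φ)`. On the lower half this is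
the steady energy identity of `e` (`steady_integral_mul_frobeniusNormSq_eq`) plus
`∫∫_{t<0} |e|² ∂ₜφ = ∫ |e|² φ(0)`; on the upper half it is the local energy inequality of the Leray
solution **from the initial time** (`IsLocalLeraySolutionOn.localEnergyIneq_initial`), whose
right-hand side carries `+∫ |u₀|² φ(0)`; and `e = u₀` on the support of `φ(0)`.
[cite: JiaSverak2014, §3 (energy inequality of the extended field, arXiv p. 8)] -/
theorem localEnergyIneq_Q (h : IsLocalLeraySolutionOn T' 1 u₀ u p)
    (hm₀ : AEStronglyMeasurable u₀ volume) (hT₀ : 0 < T₀) (hT₀T : T₀ ≤ T')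
    (he : ContDiff ℝ 2 e) (heu : ∀ x ∈ ball x₀ ρ, e x = u₀ x)
    (hdiv : ∀ x ∈ ball x₀ ρ, VectorCalculus.divergence e x = 0)
    (hG : HasWeakSpatialGradientOn (slab (EuclideanSpace ℝ (Fin 3)) (Ioo 0 T') isOpen_Ioo) u G)
    (hGb : ∀ R : ℝ, 0 < R → ∃ C : ℝ≥0, ∀ y : EuclideanSpace ℝ (Fin 3),
      ∫⁻ z in Ioo 0 T' ×ˢ ball y R, ENNReal.ofReal (frobeniusNormSq (G z.1 z.2)) ≤ C)
    (hu₁ : ∀ t, t ≤ 0 → uc t = e) (hu₂ : ∀ t, 0 < t → uc t = u t)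
    (hp₁ : ∀ t, t ≤ 0 → pc t = 0) (hp₂ : ∀ t, 0 < t → pc t = p t)
    (hf₁ : ∀ t, t ≤ 0 → fc t = fun x => convect e e x - (Δ e) x) (hf₂ : ∀ t, 0 < t → fc t = 0)
    (hG₁ : ∀ t, t ≤ 0 → Gc t = fderiv ℝ e) (hG₂ : ∀ t, 0 < t → Gc t = G t)
    {φ : ℝ → EuclideanSpace ℝ (Fin 3) → ℝ}
    (hφ : IsSpaceTimeTestOn (𝒬 : Opens (ℝ × EuclideanSpace ℝ (Fin 3))) φ) (hφ0 : ∀ t x, 0 ≤ φ t x) :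
    2 * (1 : ℝ) * ∫ t, ∫ x, frobeniusNormSq (Gc t x) * φ t x ≤
      ∫ t, ∫ x, (‖uc t x‖ ^ 2 * (timeDeriv φ t x + 1 * Δ (φ t) x) +
        (‖uc t x‖ ^ 2 + 2 * pc t x) * ⟪uc t x, gradient (φ t) x⟫ + 2 * ⟪fc t x, uc t x⟫ * φ t x) := by
  have hT : 0 < T' := hT₀.trans_le hT₀T
  have hφtop : IsSpaceTimeTestOn (⊤ : Opens (ℝ × EuclideanSpace ℝ (Fin 3))) φ := hφ.mono le_top
  have hφT : IsSpaceTimeTestOn (slab (EuclideanSpace ℝ (Fin 3)) (Iio T') isOpen_Iio) φ :=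
    hφ.mono fun z hz => mem_slab.2 (hz.1.2.trans_le hT₀T)
  have he1 : ContDiff ℝ 1 e := he.of_le one_le_two
  set Qs : Set (ℝ × EuclideanSpace ℝ (Fin 3)) := Ioo (-1 : ℝ) T₀ ×ˢ ball x₀ ρ with hQs
  have hQm : MeasurableSet Qs := measurableSet_Ioo.prod measurableSet_ball
  -- continuity of the test-function ingredients
  have cφ : Continuous (uncurry φ) := hφ.contDiff.continuous
  have cφ' : Continuous (uncurry (timeDeriv φ)) := hφ.continuous_timeDeriv
  have cL : Continuous fun z : ℝ × EuclideanSpace ℝ (Fin 3) => Δ (φ z.1) z.2 := by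
    have hh := ((hφ.isSmoothSpaceTimeOn univ).laplacian uniqueDiffOn_univ).continuousOn
    rw [univ_prod_univ, continuousOn_univ] at hh
    exact hh
  obtain ⟨cg, hcg, -⟩ := hφ.continuous_gradient_field
  have cf₀ : Continuous fun x => convect e e x - (Δ e) x :=
    (((he.continuous_fderiv (by norm_num)).clm_apply he.continuous)).sub (continuous_laplacian he)
  have ce : Continuous fun z : ℝ × EuclideanSpace ℝ (Fin 3) => e z.2 := he.continuous.comp continuous_snd
  have cF : Continuous fun x => frobeniusNormSq (fderiv ℝ e x) :=
    LerayHopfProofs.continuous_frobeniusNormSq.comp (he1.continuous_fderiv one_ne_zero)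
  -- ## the integrands and their halves
  obtain ⟨L, hL⟩ : ∃ L : ℝ × EuclideanSpace ℝ (Fin 3) → ℝ,
      L = fun z => frobeniusNormSq (Gc z.1 z.2) * φ z.1 z.2 := ⟨_, rfl⟩
  obtain ⟨L₁, hL₁⟩ : ∃ L₁ : ℝ × EuclideanSpace ℝ (Fin 3) → ℝ,
      L₁ = fun z => frobeniusNormSq (fderiv ℝ e z.2) * φ z.1 z.2 := ⟨_, rfl⟩
  obtain ⟨L₂, hL₂⟩ : ∃ L₂ : ℝ × EuclideanSpace ℝ (Fin 3) → ℝ,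
      L₂ = fun z => frobeniusNormSq (G z.1 z.2) * φ z.1 z.2 := ⟨_, rfl⟩
  obtain ⟨R, hR⟩ : ∃ R : ℝ × EuclideanSpace ℝ (Fin 3) → ℝ, R = localEnergyRHS 1 fc uc pc φ := ⟨_, rfl⟩
  obtain ⟨R₁, hR₁⟩ : ∃ R₁ : ℝ × EuclideanSpace ℝ (Fin 3) → ℝ,
      R₁ = localEnergyRHS 1 (fun _ x => convect e e x - (Δ e) x) (fun _ => e) (fun _ _ => (0 : ℝ)) φ :=
    ⟨_, rfl⟩
  obtain ⟨R₂, hR₂⟩ : ∃ R₂ : ℝ × EuclideanSpace ℝ (Fin 3) → ℝ, R₂ = localEnergyRHS 1 0 u p φ := ⟨_, rfl⟩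
  have hL_1 : ∀ z : ℝ × EuclideanSpace ℝ (Fin 3), z.1 < 0 → L z = L₁ z := fun z hz => by
    simp only [hL, hL₁, hG₁ z.1 hz.le]
  have hL_2 : ∀ z : ℝ × EuclideanSpace ℝ (Fin 3), 0 < z.1 → L z = L₂ z := fun z hz => by
    simp only [hL, hL₂, hG₂ z.1 hz]
  have hR_1 : ∀ z : ℝ × EuclideanSpace ℝ (Fin 3), z.1 < 0 → R z = R₁ z := fun z hz => by
    simp only [hR, hR₁, localEnergyRHS, hu₁ z.1 hz.le, hp₁ z.1 hz.le, hf₁ z.1 hz.le, Pi.zero_apply]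
  have hR_2 : ∀ z : ℝ × EuclideanSpace ℝ (Fin 3), 0 < z.1 → R z = R₂ z := fun z hz => by
    simp only [hR, hR₂, localEnergyRHS, hu₂ z.1 hz, hp₂ z.1 hz, hf₂ z.1 hz, Pi.zero_apply]
  -- vanishing off `Q`
  have hL0 : ∀ z, z ∉ Qs → L z = 0 := fun z hz => by
    simp only [hL, (test_derivatives_eq_zero_of_notMem hφ (t := z.1) (x := z.2) hz).1, mul_zero]
  have hL₁0 : ∀ z, z ∉ Qs → L₁ z = 0 := fun z hz => by
    simp only [hL₁, (test_derivatives_eq_zero_of_notMem hφ (t := z.1) (x := z.2) hz).1, mul_zero]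
  have hL₂0 : ∀ z, z ∉ Qs → L₂ z = 0 := fun z hz => by
    simp only [hL₂, (test_derivatives_eq_zero_of_notMem hφ (t := z.1) (x := z.2) hz).1, mul_zero]
  have hR0 : ∀ z, z ∉ Qs → R z = 0 := fun z hz => by
    rw [hR]; exact localEnergyRHS_eq_zero_of_notMem hφ hz
  have hR₁0 : ∀ z, z ∉ Qs → R₁ z = 0 := fun z hz => by
    rw [hR₁]; exact localEnergyRHS_eq_zero_of_notMem hφ hz
  have hR₂0 : ∀ z, z ∉ Qs → R₂ z = 0 := fun z hz => by
    rw [hR₂]; exact localEnergyRHS_eq_zero_of_notMem hφ hz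
  -- continuity of the steady halves
  have cL₁ : Continuous L₁ := by rw [hL₁]; exact (cF.comp continuous_snd).mul cφ
  have cR₁ : Continuous R₁ := by
    rw [hR₁]
    refine (((ce.norm.pow 2).mul (cφ'.add (continuous_const.mul cL))).add
      (((ce.norm.pow 2).add (continuous_const.mul continuous_const)).mul (ce.inner cg))).add
      ((continuous_const.mul ((cf₀.comp continuous_snd).inner ce)).mul cφ)
  -- integrability of the four halves
  have iL₁ : IntegrableOn L₁ (Qs ∩ {z | z.1 < 0}) volume := by
    rw [hQs, Q_inter_fst_lt hT₀.le]; exact integrableOn_lower_of_continuous cL₁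
  have iR₁ : IntegrableOn R₁ (Qs ∩ {z | z.1 < 0}) volume := by
    rw [hQs, Q_inter_fst_lt hT₀.le]; exact integrableOn_lower_of_continuous cR₁
  have iL₂' : IntegrableOn L₂ (Ioo 0 T' ×ˢ (univ : Set (EuclideanSpace ℝ (Fin 3)))) volume := by
    rw [hL₂]; exact integrableOn_frobeniusNormSq_mul_slab hG hGb hφtop
  have iR₂' : IntegrableOn R₂ (Ioo 0 T' ×ˢ (univ : Set (EuclideanSpace ℝ (Fin 3)))) volume := by
    rw [hR₂]; exact h.integrableOn_localEnergyRHS_slab hφtop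
  have hsub2 : Ioo (0 : ℝ) T₀ ×ˢ ball x₀ ρ ⊆ Ioo 0 T' ×ˢ (univ : Set (EuclideanSpace ℝ (Fin 3))) :=
    prod_mono (Ioo_subset_Ioo_right hT₀T) (subset_univ _)
  have iL₂ : IntegrableOn L₂ (Qs ∩ {z | 0 < z.1}) volume := by
    rw [hQs, Q_inter_lt_fst]; exact iL₂'.mono_set hsub2
  have iR₂ : IntegrableOn R₂ (Qs ∩ {z | 0 < z.1}) volume := by
    rw [hQs, Q_inter_lt_fst]; exact iR₂'.mono_set hsub2
  have iL : IntegrableOn L Qs volume := integrableOn_of_split hQm hL_1 hL_2 iL₁ iL₂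
  have iR : IntegrableOn R Qs volume := integrableOn_of_split hQm hR_1 hR_2 iR₁ iR₂
  have iLu : Integrable L volume := iL.integrable_of_forall_notMem_eq_zero hL0
  have iRu : Integrable R volume := iR.integrable_of_forall_notMem_eq_zero hR0
  -- ## iterated integrals as integrals over `Q`, split at `t = 0`
  have eL : (∫ t, ∫ x, frobeniusNormSq (Gc t x) * φ t x) =
      (∫ z in Qs ∩ {z | z.1 < 0}, L₁ z) + ∫ z in Qs ∩ {z | 0 < z.1}, L₂ z := by
    have e1 : (∫ t, ∫ x, frobeniusNormSq (Gc t x) * φ t x) = ∫ z, L z := by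
      rw [Measure.volume_eq_prod, integral_prod L (by rw [← Measure.volume_eq_prod]; exact iLu), hL]
    rw [e1, ← setIntegral_eq_integral_of_forall_compl_eq_zero (fun z hz => hL0 z hz)]
    exact setIntegral_split hQm hL_1 hL_2 iL₁ iL₂
  have eR : (∫ t, ∫ x, (‖uc t x‖ ^ 2 * (timeDeriv φ t x + 1 * Δ (φ t) x) +
        (‖uc t x‖ ^ 2 + 2 * pc t x) * ⟪uc t x, gradient (φ t) x⟫ + 2 * ⟪fc t x, uc t x⟫ * φ t x)) =
      (∫ z in Qs ∩ {z | z.1 < 0}, R₁ z) + ∫ z in Qs ∩ {z | 0 < z.1}, R₂ z := by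
    have e1 : (∫ t, ∫ x, (‖uc t x‖ ^ 2 * (timeDeriv φ t x + 1 * Δ (φ t) x) +
        (‖uc t x‖ ^ 2 + 2 * pc t x) * ⟪uc t x, gradient (φ t) x⟫ + 2 * ⟪fc t x, uc t x⟫ * φ t x)) =
        ∫ z, R z := by
      rw [Measure.volume_eq_prod, integral_prod R (by rw [← Measure.volume_eq_prod]; exact iRu), hR]
      rfl
    rw [e1, ← setIntegral_eq_integral_of_forall_compl_eq_zero (fun z hz => hR0 z hz)]
    exact setIntegral_split hQm hR_1 hR_2 iR₁ iR₂
  rw [eL, eR, hQs, Q_inter_fst_lt hT₀.le, Q_inter_lt_fst]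
  -- ## the upper halves: the local energy inequality from the initial time
  have eL₂ : ∫ z in Ioo (0 : ℝ) T₀ ×ˢ ball x₀ ρ, L₂ z =
      ∫ z in Ioo (0 : ℝ) T' ×ˢ (univ : Set (EuclideanSpace ℝ (Fin 3))), L₂ z := by
    refine (setIntegral_eq_of_subset_of_forall_sdiff_eq_zero (measurableSet_Ioo.prod MeasurableSet.univ)
      hsub2 fun z hz => hL₂0 z ?_).symm
    intro hzQ
    exact hz.2 ⟨⟨hz.1.1.1, hzQ.1.2⟩, hzQ.2⟩
  have eR₂ : ∫ z in Ioo (0 : ℝ) T₀ ×ˢ ball x₀ ρ, R₂ z =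
      ∫ z in Ioo (0 : ℝ) T' ×ˢ (univ : Set (EuclideanSpace ℝ (Fin 3))), R₂ z := by
    refine (setIntegral_eq_of_subset_of_forall_sdiff_eq_zero (measurableSet_Ioo.prod MeasurableSet.univ)
      hsub2 fun z hz => hR₂0 z ?_).symm
    intro hzQ
    exact hz.2 ⟨⟨hz.1.1.1, hzQ.1.2⟩, hzQ.2⟩
  have hLEI := h.localEnergyIneq_initial hT hm₀ hG hφT hφ0
  rw [← hL₂, ← hR₂] at hLEI
  -- ## the lower halves: the steady energy identity and the fundamental theorem of calculus
  -- (a) to the strip and to iterated integrals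
  have hsub1 : Ioo (-1 : ℝ) 0 ×ˢ ball x₀ ρ ⊆ Ioo (-1 : ℝ) 0 ×ˢ (univ : Set (EuclideanSpace ℝ (Fin 3))) :=
    prod_mono Subset.rfl (subset_univ _)
  have hdiff1 : ∀ z, z ∈ Ioo (-1 : ℝ) 0 ×ˢ (univ : Set (EuclideanSpace ℝ (Fin 3))) \ Ioo (-1 : ℝ) 0 ×ˢ ball x₀ ρ →
      z ∉ Qs := fun z hz hzQ => hz.2 ⟨hz.1.1, hzQ.2⟩
  have eL₁ : ∫ z in Ioo (-1 : ℝ) 0 ×ˢ ball x₀ ρ, L₁ z = ∫ t in Ioo (-1 : ℝ) 0, ∫ x, L₁ (t, x) := by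
    rw [← setIntegral_eq_of_subset_of_forall_sdiff_eq_zero (measurableSet_Ioo.prod MeasurableSet.univ)
      hsub1 fun z hz => hL₁0 z (hdiff1 z hz)]
    refine setIntegral_strip_eq_integral_integral ?_
    exact (integrableOn_lower_of_continuous (x₀ := x₀) (ρ := ρ) cL₁).of_forall_sdiff_eq_zero
      (measurableSet_Ioo.prod MeasurableSet.univ) fun z hz => hL₁0 z (hdiff1 z hz)
  have eR₁ : ∫ z in Ioo (-1 : ℝ) 0 ×ˢ ball x₀ ρ, R₁ z = ∫ t in Ioo (-1 : ℝ) 0, ∫ x, R₁ (t, x) := by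
    rw [← setIntegral_eq_of_subset_of_forall_sdiff_eq_zero (measurableSet_Ioo.prod MeasurableSet.univ)
      hsub1 fun z hz => hR₁0 z (hdiff1 z hz)]
    refine setIntegral_strip_eq_integral_integral ?_
    exact (integrableOn_lower_of_continuous (x₀ := x₀) (ρ := ρ) cR₁).of_forall_sdiff_eq_zero
      (measurableSet_Ioo.prod MeasurableSet.univ) fun z hz => hR₁0 z (hdiff1 z hz)
  -- (b) the steady identity on every slice
  have hK : ∀ (t : ℝ) (x : EuclideanSpace ℝ (Fin 3)), x ∉ closedBall x₀ ρ →
      ((t, x) : ℝ × EuclideanSpace ℝ (Fin 3)) ∉ Qs := fun t x hx hmem => hx (ball_subset_closedBall hmem.2)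
  have hslice : ∀ t, ∫ x, R₁ (t, x) = (∫ x, ‖e x‖ ^ 2 * timeDeriv φ t x) + 2 * ∫ x, L₁ (t, x) := by
    intro t
    have hφt2 : ContDiff ℝ 2 (φ t) := (hφtop.contDiff_slice t).of_le (by norm_cast)
    have hst := steady_integral_mul_frobeniusNormSq_eq he hφt2 (hφtop.hasCompactSupport_slice t)
      fun x hx => hdiv x (tsupport_slice_subset_ball hφ t hx)
    -- the four terms of the slice
    have cφt : Continuous (φ t) := cφ.comp (Continuous.prodMk_right t)
    have cφ't : Continuous fun x => timeDeriv φ t x := cφ'.comp (Continuous.prodMk_right t)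
    have cLt : Continuous (Δ (φ t)) := continuous_laplacian hφt2
    have cgt : Continuous fun x => gradient (φ t) x := cg.comp (Continuous.prodMk_right t)
    have hcs : ∀ {f : EuclideanSpace ℝ (Fin 3) → ℝ}, (∀ x, x ∉ closedBall x₀ ρ → f x = 0) →
        HasCompactSupport f := fun hf => HasCompactSupport.intro (isCompact_closedBall x₀ ρ) hf
    have h0t : ∀ x, x ∉ closedBall x₀ ρ → φ t x = 0 ∧ timeDeriv φ t x = 0 ∧ gradient (φ t) x = 0 ∧ Δ (φ t) x = 0 := by
      intro x hx
      obtain ⟨h1, h2, h3⟩ := test_derivatives_eq_zero_of_notMem hφ (hK t x hx)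
      exact ⟨h1, h2, by simp [gradient, h3], hφ.laplacian_slice_eq_zero (hK t x hx)⟩
    have iA : Integrable fun x => ‖e x‖ ^ 2 * timeDeriv φ t x :=
      ((he.continuous.norm.pow 2).mul cφ't).integrable_of_hasCompactSupport
        (hcs fun x hx => by show ‖e x‖ ^ 2 * timeDeriv φ t x = 0; rw [(h0t x hx).2.1, mul_zero])
    have iB : Integrable fun x => ‖e x‖ ^ 2 * (1 * Δ (φ t) x) :=
      ((he.continuous.norm.pow 2).mul (continuous_const.mul cLt)).integrable_of_hasCompactSupport
        (hcs fun x hx => by show ‖e x‖ ^ 2 * (1 * Δ (φ t) x) = 0; rw [(h0t x hx).2.2.2, mul_zero, mul_zero])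
    have iC : Integrable fun x => (‖e x‖ ^ 2 + 2 * 0) * ⟪e x, gradient (φ t) x⟫ :=
      (((he.continuous.norm.pow 2).add continuous_const).mul (he.continuous.inner cgt)).integrable_of_hasCompactSupport
        (hcs fun x hx => by
          show (‖e x‖ ^ 2 + 2 * 0) * ⟪e x, gradient (φ t) x⟫ = 0
          rw [(h0t x hx).2.2.1, inner_zero_right, mul_zero])
    have iD : Integrable fun x => 2 * ⟪convect e e x - (Δ e) x, e x⟫ * φ t x :=
      ((continuous_const.mul (cf₀.inner he.continuous)).mul cφt).integrable_of_hasCompactSupport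
        (hcs fun x hx => by show 2 * ⟪convect e e x - (Δ e) x, e x⟫ * φ t x = 0; rw [(h0t x hx).1, mul_zero])
    have iBC : Integrable fun x => ‖e x‖ ^ 2 * (1 * Δ (φ t) x) + (‖e x‖ ^ 2 + 2 * 0) * ⟪e x, gradient (φ t) x⟫ :=
      iB.add iC
    have iBCD : Integrable fun x => ‖e x‖ ^ 2 * (1 * Δ (φ t) x) + (‖e x‖ ^ 2 + 2 * 0) * ⟪e x, gradient (φ t) x⟫ +
        2 * ⟪convect e e x - (Δ e) x, e x⟫ * φ t x := iBC.add iD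
    have esplit : ∫ x, R₁ (t, x) = (∫ x, ‖e x‖ ^ 2 * timeDeriv φ t x) +
        ((∫ x, ‖e x‖ ^ 2 * (1 * Δ (φ t) x)) + (∫ x, (‖e x‖ ^ 2 + 2 * 0) * ⟪e x, gradient (φ t) x⟫) +
          ∫ x, 2 * ⟪convect e e x - (Δ e) x, e x⟫ * φ t x) := by
      have eint : (fun x => R₁ (t, x)) = fun x => ‖e x‖ ^ 2 * timeDeriv φ t x +
          (‖e x‖ ^ 2 * (1 * Δ (φ t) x) + (‖e x‖ ^ 2 + 2 * 0) * ⟪e x, gradient (φ t) x⟫ +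
            2 * ⟪convect e e x - (Δ e) x, e x⟫ * φ t x) := by
        funext x
        simp only [hR₁, localEnergyRHS]
        ring
      rw [eint, integral_add iA iBCD, integral_add iBC iD, integral_add iB iC]
    rw [esplit]
    congr 1
    -- identify the three remaining terms through the steady identity
    have e1 : ∫ x, ‖e x‖ ^ 2 * (1 * Δ (φ t) x) = ∫ x, (Δ (φ t)) x * ‖e x‖ ^ 2 :=
      integral_congr_ae (Eventually.of_forall fun x => by ring)
    have e2 : ∫ x, (‖e x‖ ^ 2 + 2 * 0) * ⟪e x, gradient (φ t) x⟫ = ∫ x, fderiv ℝ (φ t) x (e x) * ‖e x‖ ^ 2 :=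
      integral_congr_ae (Eventually.of_forall fun x => by
        show (‖e x‖ ^ 2 + 2 * 0) * ⟪e x, gradient (φ t) x⟫ = fderiv ℝ (φ t) x (e x) * ‖e x‖ ^ 2
        rw [real_inner_comm, gradient, InnerProductSpace.toDual_symm_apply]
        ring)
    have e3 : ∫ x, 2 * ⟪convect e e x - (Δ e) x, e x⟫ * φ t x = 2 * ∫ x, φ t x * ⟪convect e e x - (Δ e) x, e x⟫ := by
      rw [← integral_const_mul]
      exact integral_congr_ae (Eventually.of_forall fun x => by ring)
    have e4 : ∫ x, L₁ (t, x) = ∫ x, φ t x * frobeniusNormSq (fderiv ℝ e x) :=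
      integral_congr_ae (Eventually.of_forall fun x => by simp only [hL₁]; ring)
    rw [e1, e2, e3, e4, hst]
    ring
  -- (c) the time-derivative term by Fubini and the fundamental theorem of calculus
  have hW : ∫ t in Ioo (-1 : ℝ) 0, ∫ x, ‖e x‖ ^ 2 * timeDeriv φ t x = ∫ x, ‖u₀ x‖ ^ 2 * φ 0 x := by
    have hc : Continuous (uncurry fun t x => ‖e x‖ ^ 2 * timeDeriv φ t x) := (ce.norm.pow 2).mul cφ'
    have hcs : HasCompactSupport (uncurry fun t x => ‖e x‖ ^ 2 * timeDeriv φ t x) := by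
      refine (hφtop.timeDeriv_top.hasCompactSupport).mono fun z hz => ?_
      contrapose! hz
      simp only [mem_support, not_not] at hz
      simp only [mem_support, not_not, uncurry]
      show ‖e z.2‖ ^ 2 * timeDeriv φ z.1 z.2 = 0
      rw [show timeDeriv φ z.1 z.2 = uncurry (timeDeriv φ) z from rfl, hz, mul_zero]
    have hI : Integrable (uncurry fun t x => ‖e x‖ ^ 2 * timeDeriv φ t x)
        (volume : Measure (ℝ × EuclideanSpace ℝ (Fin 3))) := hc.integrable_of_hasCompactSupport hcs
    rw [Measure.volume_eq_prod] at hI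
    have hH := hI.mono_measure (Measure.prod_mono (Measure.restrict_le_self (s := Ioo (-1 : ℝ) 0)) le_rfl)
    rw [integral_integral_swap hH]
    refine integral_congr_ae (Eventually.of_forall fun x => ?_)
    show ∫ t in Ioo (-1 : ℝ) 0, ‖e x‖ ^ 2 * timeDeriv φ t x = ‖u₀ x‖ ^ 2 * φ 0 x
    have hct : Continuous fun t => timeDeriv φ t x := cφ'.comp (Continuous.prodMk_left x)
    rw [integral_const_mul]
    have hFTC : ∫ t in Ioo (-1 : ℝ) 0, timeDeriv φ t x = φ 0 x - φ (-1) x := by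
      rw [← integral_Ioc_eq_integral_Ioo, ← intervalIntegral.integral_of_le (by norm_num)]
      exact intervalIntegral.integral_eq_sub_of_hasDerivAt (fun t _ => hφtop.hasDerivAt_time t x)
        (hct.intervalIntegrable _ _)
    have hφm1 : φ (-1) x = 0 := hφ.apply_eq_zero (fun hmem => by
      have : (-1 : ℝ) ∈ Ioo (-1 : ℝ) T₀ := hmem.1
      exact lt_irrefl _ this.1)
    rw [hFTC, hφm1, sub_zero]
    by_cases hx : x ∈ ball x₀ ρ
    · rw [heu x hx]
    · have : φ 0 x = 0 := hφ.apply_eq_zero (fun hmem => hx hmem.2)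
      rw [this, mul_zero, mul_zero]
  -- (d) the dissipation term of the lower half, back to the box
  have iW : Integrable (fun t => ∫ x, ‖e x‖ ^ 2 * timeDeriv φ t x) ((volume : Measure ℝ).restrict (Ioo (-1 : ℝ) 0)) := by
    have hc : Continuous (uncurry fun t x => ‖e x‖ ^ 2 * timeDeriv φ t x) := (ce.norm.pow 2).mul cφ'
    have hcs : HasCompactSupport (uncurry fun t x => ‖e x‖ ^ 2 * timeDeriv φ t x) := by
      refine (hφtop.timeDeriv_top.hasCompactSupport).mono fun z hz => ?_
      contrapose! hz
      simp only [mem_support, not_not] at hz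
      simp only [mem_support, not_not, uncurry]
      show ‖e z.2‖ ^ 2 * timeDeriv φ z.1 z.2 = 0
      rw [show timeDeriv φ z.1 z.2 = uncurry (timeDeriv φ) z from rfl, hz, mul_zero]
    have hI : Integrable (uncurry fun t x => ‖e x‖ ^ 2 * timeDeriv φ t x)
        (volume : Measure (ℝ × EuclideanSpace ℝ (Fin 3))) := hc.integrable_of_hasCompactSupport hcs
    rw [Measure.volume_eq_prod] at hI
    have hH := hI.mono_measure (Measure.prod_mono (Measure.restrict_le_self (s := Ioo (-1 : ℝ) 0)) le_rfl)
    exact hH.integral_prod_left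
  have iL₁t : Integrable (fun t => ∫ x, L₁ (t, x)) ((volume : Measure ℝ).restrict (Ioo (-1 : ℝ) 0)) := by
    have hI₁ : IntegrableOn L₁ (Ioo (-1 : ℝ) 0 ×ˢ (univ : Set (EuclideanSpace ℝ (Fin 3)))) volume :=
      (integrableOn_lower_of_continuous (x₀ := x₀) (ρ := ρ) cL₁).of_forall_sdiff_eq_zero
        (measurableSet_Ioo.prod MeasurableSet.univ) fun z hz => hL₁0 z (hdiff1 z hz)
    have e : ((volume : Measure (ℝ × EuclideanSpace ℝ (Fin 3))).restrict (Ioo (-1 : ℝ) 0 ×ˢ (univ : Set (EuclideanSpace ℝ (Fin 3))))) =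
        ((volume : Measure ℝ).restrict (Ioo (-1 : ℝ) 0)).prod (volume : Measure (EuclideanSpace ℝ (Fin 3))) := by
      rw [Measure.volume_eq_prod, Measure.restrict_prod_eq_prod_univ]
    rw [IntegrableOn, e] at hI₁
    exact hI₁.integral_prod_left
  have eR₁' : ∫ t in Ioo (-1 : ℝ) 0, ∫ x, R₁ (t, x) =
      (∫ x, ‖u₀ x‖ ^ 2 * φ 0 x) + 2 * ∫ z in Ioo (-1 : ℝ) 0 ×ˢ ball x₀ ρ, L₁ z := by
    simp_rw [hslice]
    rw [integral_add iW (iL₁t.const_mul 2), integral_const_mul, hW, eL₁]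
  -- ## assemble
  rw [eL₂, eR₂, eR₁, eR₁']
  have hDL : 0 ≤ ∫ z in Ioo (-1 : ℝ) 0 ×ˢ ball x₀ ρ, L₁ z :=
    setIntegral_nonneg (measurableSet_Ioo.prod measurableSet_ball) fun z _ => by
      rw [hL₁]; exact mul_nonneg (frobeniusNormSq_nonneg _) (hφ0 _ _)
  nlinarith [hLEI, hDL]

end Continuation

end JiaSverak2014

end Literature.Analysis.FluidPDE
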